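import Literature.NumberTheory.LFunctions.BettinConreyFarmer2013Psi
import Literature.NumberTheory.LFunctions.ZetaZeroReciprocalSum
import Literature.NumberTheory.LFunctions.SimpleZeros
import Literature.Analysis.Complex.VerticalLineShift
import HarnessLib

/-!
# Bettin–Conrey–Farmer 2013, Theorem 1 — the proof

Topic `Literature/NumberTheory/LFunctions`; final "Proofs" companion of
`BettinConreyFarmer2013.lean` (chain `…Zeros → …ZeroSums → …LocalFactor / …ExplicitFormula →
…ZeroSumAnalytic → …Psi → this file`): here the named fact
`Literature.NumberTheory.LFunctions.BettinConreyFarmer2013_thm1` is DISCHARGED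
(`BettinConreyFarmer2013_thm1_holds`, at the end). Everything is PROVED; the definitions
(`BCF.Setting`, `BCF.Efn`, `BCF.fA1/fA2/fA3`) are explicit abbreviations internal to the proof.

The proof follows [BettinConreyFarmer2013, §3, proof of Theorem 1]:

1. `(1/2π) ∫ |1 − ζV_N(1/2+it)|² dt/(1/4+t²) = (1/2π) ∫_{(1/2)} f(s)f(1−s)/(s(1−s)) |ds|` with
   `f = 1 − ζV_N` (on the critical line `1 − s = s̄` and `f(s̄) = \overline{f(s)}`:
   `BCF.criticalLine_identity`, `BCF.bcfDistSq_eq_integral`).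
2. "We start by moving the line of integration to `Re s = 1/2 + ε`": the integrand is holomorphic
   in `0 < Re s < 1` and `≪_N (1+|t|)^{4ε−2}` for `|Re s − 1/2| ≤ ε` (`BCF.norm_FN_le`), so the
   tree's `integral_vertical_eq_of_differentiableOn` applies (`BCF.integral_shift`).
3. On the new line, by the explicit formula (Lemma 2, `BCF.levinson_explicit`),
   `log N · f = A₁ − A₂ − A₃` with `A₁ = ζ'/ζ`, `A₂ = ζ·Z_N`, `A₃ = ζ·E_N` (`BCF.log_mul_sub_eq`;
   `E_N` is the left-line term, `‖E_N(s)‖ ≪ N^{1/4−Re s}`, `BCF.norm_Efn_le`), at `s` and at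
   `1 − s` (display (tt)). Part 1 of this file bounds the six factors on the line
   (`BCF.exists_factor_bounds`) and shows that a product `X(s)Y(1−s)/(s(1−s))` with
   `‖X‖‖Y‖ ≪ (1+|t|)^{q}`, `q < 1`, is integrable with bounded integral (`BCF.minor_term`: seven of
   the nine products); Part 2 treats `A₂(s)A₂(1−s)` by exchanging the `t`-integral with the sum
   over zeros (Tonelli; each zero contributes `≪ |ρ|^{p}/ε + |ρ|^{−2}`, summable against
   `1/|ζ'(ρ)|` by the partial-summation consequence of (2), `BCF.summable_inv_deriv_mul_norm_rpow`)
   — `BCF.exists_A2B2`; the remaining product `−A₁(s)A₂(1−s)/(s(1−s)) = −Ψ_N(1−s)` is the main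
   term, `= 2π log N ∑_ρ 1/(ρ(1−ρ)) + O(1)` by `BCF.exists_main_term` (previous file). Together:
   `BCF.exists_line_bound`, `‖log²N ∫ F_N(1/2+ε+it) dt − 2π log N ∑_ρ 1/(ρ(1−ρ))‖ ≤ K`.
4. Under simple zeros `∑_ρ 1/(ρ(1−ρ)) = ∑_ρ m(ρ)/(ρ(1−ρ)) = β = 2 + γ − log π − 2 log 2 = 2 + γ − log 4π`
   (Nicolas's `β`, `hasSum_zeroOrder_div_mul_one_sub` of `ZetaZeroReciprocalSum.lean`;
   `BCF.tsum_inv_mul_one_sub_eq`, `BCF.nicolasBeta_eq`), whence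
   `|bcfDistSq N − β/log N| ≤ K/(2π log²N)` for `N ≥ 2` and the asymptotic equivalence.

The parameter `ε` of the paper is taken as `min(1/16, δ/16)` and `δ` is replaced by `min(δ,1)`
(harmless since `T ≥ 2`); these standing data are bundled in `BCF.Setting`, which the final
theorem builds from the hypotheses `RiemannHypothesis` and `BettinConreyFarmer2013_hyp`.

## References

* S. Bettin, J. B. Conrey, D. W. Farmer, *An optimal choice of Dirichlet polynomials for the
  Nyman–Beurling criterion*, Proc. Steklov Inst. Math. 280 (2013), suppl. 2, S30–S36
  (arXiv:1211.5191), Theorem 1 and §3. [BettinConreyFarmer2013]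
* J.-L. Nicolas, *Small values of the Euler function and the Riemann hypothesis*, Acta Arith. 155
  (2012), (1.3) (the constant `β = ∑_ρ 1/(ρ(1−ρ))`). [Nicolas2012]
-/

noncomputable section

open Complex Filter Set Real Metric MeasureTheory
open scoped Topology ComplexConjugate

namespace Literature.NumberTheory.LFunctions

namespace BCF

open Literature.Barriers.RiemannHypothesis (levinsonMollifier)

/-! ## The standing hypotheses -/

/-- The standing hypotheses of the proof of Theorem 1 of [BettinConreyFarmer2013]: RH, all
non-trivial zeros simple, condition (2) `∑_{0<Im ρ≤T} |ζ'(ρ)|⁻² ≤ C T^{3/2−δ}` (`T ≥ 2`) with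
`0 < δ ≤ 1`, and the auxiliary parameter `ε` of the proof with `0 < ε`, `16ε ≤ min(1, δ)`.
[cite: BettinConreyFarmer2013, Thm. 1 (hypotheses) and §3 (the parameter ε)] -/
structure Setting where
  /-- the exponent saving of condition (2) -/
  δ : ℝ
  /-- the constant of condition (2) -/
  C : ℝ
  /-- the distance of the line of integration from the critical line -/
  ε : ℝ
  hδ : 0 < δ
  hδ1 : δ ≤ 1
  hε : 0 < ε
  hε16 : ε ≤ 1 / 16
  hεδ : 16 * ε ≤ δ
  hRH : RiemannHypothesis
  hsimp : ∀ ρ : ℂ, riemannZeta ρ = 0 → 0 < ρ.re → ρ.re < 1 → deriv riemannZeta ρ ≠ 0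
  hC : ∀ T : ℝ, 2 ≤ T →
    ∑ᶠ ρ ∈ zetaZeroBox 0 T, 1 / ‖deriv riemannZeta ρ‖ ^ 2 ≤ C * T ^ (3 / 2 - δ)

/-! ## The quantity `E_N` and the factors -/

/-- `E_N(s) = log N·V_N(s) − log N/ζ(s) + ζ'(s)/ζ(s)² − Z_N(s)` (equal to the left-line term on
the lines of integration, `Efn_eq_leftLineTerm`). [cite: BettinConreyFarmer2013, §3, Lemma 2] -/
def Efn (N : ℕ) (s : ℂ) : ℂ :=
  (Real.log N : ℂ) * levinsonMollifier N s - (Real.log N : ℂ) / riemannZeta s +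
    deriv riemannZeta s / riemannZeta s ^ 2 - zeroSum N s

/-- `A₁(s) = ζ'/ζ(s)`. [cite: BettinConreyFarmer2013, §3, proof of Thm. 1 (display tt)] -/
def fA1 (s : ℂ) : ℂ := deriv riemannZeta s / riemannZeta s

/-- `A₂(s) = ζ(s) Z_N(s)`. [cite: BettinConreyFarmer2013, §3, proof of Thm. 1 (display tt)] -/
def fA2 (N : ℕ) (s : ℂ) : ℂ := riemannZeta s * zeroSum N s

/-- `A₃(s) = ζ(s) E_N(s)`. [cite: BettinConreyFarmer2013, §3, proof of Thm. 1 (display tt)] -/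
def fA3 (N : ℕ) (s : ℂ) : ℂ := riemannZeta s * Efn N s

/-- **`log N · (1 − ζ(s)V_N(s)) = A₁ − A₂ − A₃`** wherever `ζ(s) ≠ 0` (an algebraic identity, by
the definition of `E_N`). [cite: BettinConreyFarmer2013, §3, proof of Thm. 1 (display tt)] -/
theorem log_mul_sub_eq (N : ℕ) {s : ℂ} (hζ : riemannZeta s ≠ 0) :
    (Real.log N : ℂ) * (1 - riemannZeta s * levinsonMollifier N s) = fA1 s - fA2 N s - fA3 N s := by
  simp only [fA1, fA2, fA3, Efn]
  field_simp
  ring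

/-- On the lines of integration `E_N` is the left-line term of the explicit formula. [cite: BettinConreyFarmer2013, §3, Lemma 2] -/
theorem Efn_eq_leftLineTerm (S : Setting) {N : ℕ} (hN : 2 ≤ N) {s : ℂ} (h1 : 3 / 8 ≤ s.re) (h2 : s.re < 1)
    (h3 : s.re ≠ 1 / 2) : Efn N s = leftLineTerm N s := by
  have h := levinson_explicit S.hRH S.hsimp S.hδ S.hδ1 S.hC hN h1 h2 h3
  rw [Efn, h]; ring

/-- **`‖E_N(s)‖ ≤ 32 B_q N^{1/4 − Re s}`** on the lines (`3/8 ≤ Re s < 1`, `Re s ≠ 1/2`), `B_q` the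
bound for `1/ζ` on `Re = 1/4`. [cite: BettinConreyFarmer2013, §3, Lemma 2 (error term)] -/
theorem norm_Efn_le (S : Setting) {Bq : ℝ} (hBq : ∀ t : ℝ, ‖(riemannZeta (1 / 4 + t * I))⁻¹‖ ≤ Bq)
    {N : ℕ} (hN : 2 ≤ N) {s : ℂ} (h1 : 3 / 8 ≤ s.re) (h2 : s.re < 1) (h3 : s.re ≠ 1 / 2) :
    ‖Efn N s‖ ≤ 32 * Bq * (N : ℝ) ^ (1 / 4 - s.re) := by
  rw [Efn_eq_leftLineTerm S hN h1 h2 h3]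
  exact norm_leftLineTerm_le S.hRH hN h1 hBq

/-! ## Continuity on the line -/

/-- `V_N` is continuous. [folklore] -/
theorem continuous_levinsonMollifier (N : ℕ) : Continuous (levinsonMollifier N) := by
  unfold levinsonMollifier
  refine continuous_finsetSum _ fun n hn ↦ ?_
  have hn1 : 1 ≤ n := (Finset.mem_Icc.1 hn).1
  exact continuous_const.mul (continuous_const.cpow continuous_neg (fun s ↦ Or.inl (by
    simp; omega)))

/-- The six factors are continuous along `Re s = x` and along `1 − s`, for `x ∈ [3/8, 5/8]`,
`x ≠ 1/2` (no zeros, no pole). [folklore] -/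
theorem continuous_factors (S : Setting) {N : ℕ} (hN : 2 ≤ N) {x : ℝ} (hx1 : 3 / 8 ≤ x) (hx2 : x ≤ 5 / 8) (hx : x ≠ 1 / 2) :
    (Continuous fun t : ℝ ↦ fA1 (x + t * I)) ∧ (Continuous fun t : ℝ ↦ fA2 N (x + t * I)) ∧
    (Continuous fun t : ℝ ↦ fA3 N (x + t * I)) := by
  have hpt : ∀ t : ℝ, ((x : ℂ) + t * I) ≠ 1 ∧ riemannZeta ((x : ℂ) + t * I) ≠ 0 ∧
      ((x : ℂ) + t * I) ∉ ZetaZeros.riemannZetaNontrivialZeros := by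
    intro t
    have h1 : ((x : ℂ) + t * I) ≠ 1 := by
      intro h; have := congrArg Complex.re h; simp at this; linarith
    have hζ : riemannZeta ((x : ℂ) + t * I) ≠ 0 :=
      riemannZeta_ne_zero_of_riemannHypothesis S.hRH (by simp; linarith) (by simpa using hx)
    exact ⟨h1, hζ, fun h ↦ hζ (ZetaZeros.riemannZetaNontrivialZeros.mem_iff'.1 h).1⟩
  have hline : Continuous fun t : ℝ ↦ (x : ℂ) + t * I := by fun_prop
  have hζc : Continuous fun t : ℝ ↦ riemannZeta ((x : ℂ) + t * I) :=
    continuous_iff_continuousAt.2 fun t ↦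
      (differentiableAt_riemannZeta (hpt t).1).continuousAt.comp
        (f := fun t : ℝ ↦ (x : ℂ) + t * I) hline.continuousAt
  have hζ'c : Continuous fun t : ℝ ↦ deriv riemannZeta ((x : ℂ) + t * I) :=
    continuous_iff_continuousAt.2 fun t ↦
      (analyticOn_riemannZeta _ (hpt t).1).deriv.continuousAt.comp
        (f := fun t : ℝ ↦ (x : ℂ) + t * I) hline.continuousAt
  have hZc : Continuous fun t : ℝ ↦ zeroSum N ((x : ℂ) + t * I) :=
    continuous_iff_continuousAt.2 fun t ↦
      (analyticAt_zeroSum S.hRH S.hδ S.hC hN (hpt t).2.2).continuousAt.comp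
        (f := fun t : ℝ ↦ (x : ℂ) + t * I) hline.continuousAt
  have hVc : Continuous fun t : ℝ ↦ levinsonMollifier N ((x : ℂ) + t * I) :=
    (continuous_levinsonMollifier N).comp hline
  refine ⟨hζ'c.div hζc fun t ↦ (hpt t).2.1, hζc.mul hZc, hζc.mul ?_⟩
  unfold Efn
  exact (((continuous_const.mul hVc).sub (continuous_const.div hζc fun t ↦ (hpt t).2.1)).add
    (hζ'c.div (hζc.pow 2) fun t ↦ pow_ne_zero 2 (hpt t).2.1)).sub hZc

/-! ## Bounds for the factors on the line `Re s = 1/2 + ε` -/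

/-- `N^{a} ≤ 1` for `a ≤ 0`, `N ≥ 1`. [folklore] -/
theorem natCast_rpow_le_one {N : ℕ} (hN : 1 ≤ N) {a : ℝ} (ha : a ≤ 0) : (N : ℝ) ^ a ≤ 1 :=
  Real.rpow_le_one_of_one_le_of_nonpos (by exact_mod_cast hN) ha

set_option maxHeartbeats 400000 in
/-- **Uniform bounds for the six factors on the line `Re s = 1/2 + ε`.** There is `c > 0` such
that for all `N ≥ 2` and real `t`, with `s = 1/2 + ε + it`, `u = 1 + |t|`, `z = 2ε + 3/4 − δ/4`:
`‖A₁(s)‖, ‖A₁(1−s)‖, ‖A₃(1−s)‖ ≤ c u^{1/4}`; `‖A₃(s)‖ ≤ c N^{−1/4} u^{1/4}`;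
`‖A₂(s)‖ ≤ c N^{−ε} u^{z}`; `‖A₂(1−s)‖ ≤ c N^{ε} u^{z}`; and `‖ζ(s)‖, ‖ζ(1−s)‖ ≤ c u^{2ε}`.
[cite: BettinConreyFarmer2013, §3, proof of Thm. 1] -/
theorem exists_factor_bounds (S : Setting) :
    ∃ c : ℝ, 0 < c ∧ ∀ N : ℕ, 2 ≤ N → ∀ t : ℝ,
      ‖fA1 (((1 / 2 + S.ε : ℝ) : ℂ) + t * I)‖ ≤ c * (1 + |t|) ^ (1 / 4 : ℝ) ∧
      ‖fA1 (1 - (((1 / 2 + S.ε : ℝ) : ℂ) + t * I))‖ ≤ c * (1 + |t|) ^ (1 / 4 : ℝ) ∧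
      ‖fA3 N (((1 / 2 + S.ε : ℝ) : ℂ) + t * I)‖ ≤ c * (N : ℝ) ^ (-(1 / 4 : ℝ)) * (1 + |t|) ^ (1 / 4 : ℝ) ∧
      ‖fA3 N (1 - (((1 / 2 + S.ε : ℝ) : ℂ) + t * I))‖ ≤ c * (1 + |t|) ^ (1 / 4 : ℝ) ∧
      ‖fA2 N (((1 / 2 + S.ε : ℝ) : ℂ) + t * I)‖ ≤
        c * (N : ℝ) ^ (-S.ε) * (1 + |t|) ^ (2 * S.ε + 3 / 4 - S.δ / 4) ∧
      ‖fA2 N (1 - (((1 / 2 + S.ε : ℝ) : ℂ) + t * I))‖ ≤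
        c * (N : ℝ) ^ S.ε * (1 + |t|) ^ (2 * S.ε + 3 / 4 - S.δ / 4) ∧
      ‖riemannZeta (((1 / 2 + S.ε : ℝ) : ℂ) + t * I)‖ ≤ c * (1 + |t|) ^ (2 * S.ε) ∧
      ‖riemannZeta (1 - (((1 / 2 + S.ε : ℝ) : ℂ) + t * I))‖ ≤ c * (1 + |t|) ^ (2 * S.ε) := by
  have hε := S.hε; have hε16 := S.hε16; have hδ := S.hδ; have hδ1 := S.hδ1
  obtain ⟨Cl, hCl0, hCl⟩ := exists_norm_logDeriv_line_le S.hRH hε (by linarith)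
  obtain ⟨Cs, hCs0, hCs⟩ := exists_norm_zeta_le_strip S.hRH hε (by linarith)
  obtain ⟨K₃, hK₃0, hK₃⟩ := exists_lemma3 S.hRH S.hsimp hδ hδ1 S.hC
  obtain ⟨Bq, hBq0, hBq⟩ := ZetaDerivReciprocalSeries.exists_bound_inv_zeta_quarter S.hRH
  set c : ℝ := 16 * Cl + 2 * Cs * (K₃ * S.ε⁻¹ ^ 2) + 2 * Cs * (32 * Bq) + 2 * Cs + 1 with hc
  have hp1 : 0 ≤ 2 * Cs * (K₃ * S.ε⁻¹ ^ 2) := by positivity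
  have hp2 : 0 ≤ 2 * Cs * (32 * Bq) := by positivity
  have hp3 : 0 ≤ 2 * Cs := by positivity
  have hp4 : 0 ≤ 16 * Cl := by positivity
  have hc1 : 16 * Cl ≤ c := by rw [hc]; linarith
  have hc2 : 2 * Cs * (K₃ * S.ε⁻¹ ^ 2) ≤ c := by rw [hc]; linarith
  have hc3 : 2 * Cs * (32 * Bq) ≤ c := by rw [hc]; linarith
  have hc4 : 2 * Cs ≤ c := by rw [hc]; linarith
  refine ⟨c, by positivity, fun N hN t ↦ ?_⟩
  have hN1 : 1 ≤ N := by omega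
  set a : ℝ := 1 / 2 + S.ε with ha
  set s : ℂ := (a : ℂ) + t * I with hs
  have hsre : s.re = a := by simp [hs]
  have hsim : s.im = t := by simp [hs]
  have h1s : 1 - s = ((1 - a : ℝ) : ℂ) + ((-t : ℝ) : ℂ) * I := by rw [hs]; push_cast; ring
  have h1sre : (1 - s).re = 1 - a := by rw [h1s]; simp
  have h1sim : (1 - s).im = -t := by rw [h1s]; simp
  set u : ℝ := 1 + |t| with hu
  have hu1 : 1 ≤ u := by rw [hu]; linarith [abs_nonneg t]
  have hu0 : 0 < u := by linarith
  have hupow : ∀ {p q : ℝ}, p ≤ q → u ^ p ≤ u ^ q := fun h ↦ Real.rpow_le_rpow_of_exponent_le hu1 h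
  -- the logarithmic derivatives
  have hlog : Real.log (|t| + 2) ≤ 16 * u ^ (1 / 4 : ℝ) :=
    (log_abs_add_two_le t).trans (mul_le_mul_of_nonneg_left (hupow (by norm_num)) (by norm_num))
  have hA1 : ‖fA1 s‖ ≤ c * u ^ (1 / 4 : ℝ) := by
    have := (hCl a t ⟨by rw [ha]; linarith, by rw [ha]; linarith⟩ (by
      rw [ha, show (1 / 2 + S.ε) - 1 / 2 = S.ε by ring, abs_of_pos hε])).2
    rw [← hs] at this
    unfold fA1
    calc _ ≤ Cl * Real.log (|t| + 2) := this
      _ ≤ Cl * (16 * u ^ (1 / 4 : ℝ)) := mul_le_mul_of_nonneg_left hlog hCl0.le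
      _ = 16 * Cl * u ^ (1 / 4 : ℝ) := by ring
      _ ≤ c * u ^ (1 / 4 : ℝ) := mul_le_mul_of_nonneg_right hc1 (by positivity)
  have hB1 : ‖fA1 (1 - s)‖ ≤ c * u ^ (1 / 4 : ℝ) := by
    have := (hCl (1 - a) (-t) ⟨by rw [ha]; linarith, by rw [ha]; linarith⟩ (by
      rw [ha, show 1 - (1 / 2 + S.ε) - 1 / 2 = -S.ε by ring, abs_neg, abs_of_pos hε])).2
    rw [← h1s, abs_neg] at this
    unfold fA1
    calc _ ≤ Cl * Real.log (|t| + 2) := this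
      _ ≤ Cl * (16 * u ^ (1 / 4 : ℝ)) := mul_le_mul_of_nonneg_left hlog hCl0.le
      _ = 16 * Cl * u ^ (1 / 4 : ℝ) := by ring
      _ ≤ c * u ^ (1 / 4 : ℝ) := mul_le_mul_of_nonneg_right hc1 (by positivity)
  -- `ζ`
  have hζ : ‖riemannZeta s‖ ≤ 2 * Cs * u ^ (2 * S.ε) := by
    have := hCs s (by rw [hsre, ha]; linarith) (by rw [hsre, ha])
    rw [hsim] at this
    calc _ ≤ Cs * (2 + |t|) ^ (2 * S.ε) := this
      _ ≤ Cs * (2 * u ^ (2 * S.ε)) :=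
          mul_le_mul_of_nonneg_left (two_add_rpow_le t (by linarith) (by linarith)) hCs0.le
      _ = 2 * Cs * u ^ (2 * S.ε) := by ring
  have hζ' : ‖riemannZeta (1 - s)‖ ≤ 2 * Cs * u ^ (2 * S.ε) := by
    have := hCs (1 - s) (by rw [h1sre, ha]; linarith) (by rw [h1sre, ha]; linarith)
    rw [h1sim, abs_neg] at this
    calc _ ≤ Cs * (2 + |t|) ^ (2 * S.ε) := this
      _ ≤ Cs * (2 * u ^ (2 * S.ε)) :=
          mul_le_mul_of_nonneg_left (two_add_rpow_le t (by linarith) (by linarith)) hCs0.le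
      _ = 2 * Cs * u ^ (2 * S.ε) := by ring
  -- `Z_N`
  have hZ : ‖zeroSum N s‖ ≤ (N : ℝ) ^ (-S.ε) * (K₃ * S.ε⁻¹ ^ 2 * u ^ (3 / 4 - S.δ / 4)) := by
    have hB := hK₃ S.ε hε (by linarith) s (by rw [hsre, ha]; simp [abs_of_pos hε])
      (by rw [hsre, ha]; rw [show (1 / 2 + S.ε) - 1 / 2 = S.ε by ring, abs_of_pos hε]; linarith)
    rw [hsim] at hB
    have := norm_zeroSum_le_of_sum_le S.hRH hN hB
    rwa [hsre, ha, show (1 / 2 - (1 / 2 + S.ε) : ℝ) = -S.ε by ring] at this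
  have hZ' : ‖zeroSum N (1 - s)‖ ≤ (N : ℝ) ^ S.ε * (K₃ * S.ε⁻¹ ^ 2 * u ^ (3 / 4 - S.δ / 4)) := by
    have hB := hK₃ S.ε hε (by linarith) (1 - s)
      (by rw [h1sre, ha, show 1 - (1 / 2 + S.ε) - 1 / 2 = -S.ε by ring, abs_neg, abs_of_pos hε])
      (by rw [h1sre, ha, show 1 - (1 / 2 + S.ε) - 1 / 2 = -S.ε by ring, abs_neg, abs_of_pos hε]; linarith)
    rw [h1sim, abs_neg] at hB
    have := norm_zeroSum_le_of_sum_le S.hRH hN hB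
    rwa [h1sre, ha, show (1 / 2 - (1 - (1 / 2 + S.ε)) : ℝ) = S.ε by ring] at this
  -- `E_N`
  have hE : ‖Efn N s‖ ≤ 32 * Bq * (N : ℝ) ^ (-(1 / 4 : ℝ)) := by
    have := norm_Efn_le S hBq hN (s := s) (by rw [hsre, ha]; linarith) (by rw [hsre, ha]; linarith)
      (by rw [hsre, ha]; linarith)
    rw [hsre, ha] at this
    refine this.trans (mul_le_mul_of_nonneg_left ?_ (by positivity))
    exact Real.rpow_le_rpow_of_exponent_le (by exact_mod_cast hN1) (by linarith)
  have hE' : ‖Efn N (1 - s)‖ ≤ 32 * Bq := by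
    have := norm_Efn_le S hBq hN (s := 1 - s) (by rw [h1sre, ha]; linarith) (by rw [h1sre, ha]; linarith)
      (by rw [h1sre, ha]; linarith)
    rw [h1sre, ha] at this
    refine this.trans ?_
    have : (N : ℝ) ^ (1 / 4 - (1 - (1 / 2 + S.ε))) ≤ 1 := natCast_rpow_le_one hN1 (by linarith)
    have h0 : 0 ≤ 32 * Bq := by positivity
    nlinarith
  -- assemble
  have hu2ε : u ^ (2 * S.ε) ≤ u ^ (1 / 4 : ℝ) := hupow (by linarith)
  refine ⟨hA1, hB1, ?_, ?_, ?_, ?_, hζ.trans (mul_le_mul_of_nonneg_right hc4 (by positivity)),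
    hζ'.trans (mul_le_mul_of_nonneg_right hc4 (by positivity))⟩
  · unfold fA3; rw [norm_mul]
    calc ‖riemannZeta s‖ * ‖Efn N s‖ ≤ (2 * Cs * u ^ (2 * S.ε)) * (32 * Bq * (N : ℝ) ^ (-(1 / 4 : ℝ))) :=
          mul_le_mul hζ hE (norm_nonneg _) (by positivity)
      _ = (2 * Cs * (32 * Bq)) * (N : ℝ) ^ (-(1 / 4 : ℝ)) * u ^ (2 * S.ε) := by ring
      _ ≤ c * (N : ℝ) ^ (-(1 / 4 : ℝ)) * u ^ (1 / 4 : ℝ) :=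
          mul_le_mul (mul_le_mul_of_nonneg_right hc3 (by positivity)) hu2ε (by positivity) (by positivity)
  · unfold fA3; rw [norm_mul]
    calc ‖riemannZeta (1 - s)‖ * ‖Efn N (1 - s)‖ ≤ (2 * Cs * u ^ (2 * S.ε)) * (32 * Bq) :=
          mul_le_mul hζ' hE' (norm_nonneg _) (by positivity)
      _ = (2 * Cs * (32 * Bq)) * u ^ (2 * S.ε) := by ring
      _ ≤ c * u ^ (1 / 4 : ℝ) := mul_le_mul hc3 hu2ε (by positivity) (by positivity)
  · unfold fA2; rw [norm_mul]
    calc ‖riemannZeta s‖ * ‖zeroSum N s‖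
        ≤ (2 * Cs * u ^ (2 * S.ε)) * ((N : ℝ) ^ (-S.ε) * (K₃ * S.ε⁻¹ ^ 2 * u ^ (3 / 4 - S.δ / 4))) :=
          mul_le_mul hζ hZ (norm_nonneg _) (by positivity)
      _ = (2 * Cs * (K₃ * S.ε⁻¹ ^ 2)) * (N : ℝ) ^ (-S.ε) * (u ^ (2 * S.ε) * u ^ (3 / 4 - S.δ / 4)) := by ring
      _ = (2 * Cs * (K₃ * S.ε⁻¹ ^ 2)) * (N : ℝ) ^ (-S.ε) * u ^ (2 * S.ε + 3 / 4 - S.δ / 4) := by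
          rw [← Real.rpow_add hu0]; ring_nf
      _ ≤ c * (N : ℝ) ^ (-S.ε) * u ^ (2 * S.ε + 3 / 4 - S.δ / 4) :=
          mul_le_mul_of_nonneg_right (mul_le_mul_of_nonneg_right hc2 (by positivity)) (by positivity)
  · unfold fA2; rw [norm_mul]
    calc ‖riemannZeta (1 - s)‖ * ‖zeroSum N (1 - s)‖
        ≤ (2 * Cs * u ^ (2 * S.ε)) * ((N : ℝ) ^ S.ε * (K₃ * S.ε⁻¹ ^ 2 * u ^ (3 / 4 - S.δ / 4))) :=
          mul_le_mul hζ' hZ' (norm_nonneg _) (by positivity)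
      _ = (2 * Cs * (K₃ * S.ε⁻¹ ^ 2)) * (N : ℝ) ^ S.ε * (u ^ (2 * S.ε) * u ^ (3 / 4 - S.δ / 4)) := by ring
      _ = (2 * Cs * (K₃ * S.ε⁻¹ ^ 2)) * (N : ℝ) ^ S.ε * u ^ (2 * S.ε + 3 / 4 - S.δ / 4) := by
          rw [← Real.rpow_add hu0]; ring_nf
      _ ≤ c * (N : ℝ) ^ S.ε * u ^ (2 * S.ε + 3 / 4 - S.δ / 4) :=
          mul_le_mul_of_nonneg_right (mul_le_mul_of_nonneg_right hc2 (by positivity)) (by positivity)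

/-! ## The minor cross terms -/

/-- **A minor cross term is integrable with bounded integral.** On the line `s = 1/2 + ε + it`:
if `X, Y : ℝ → ℂ` are continuous with `‖X(t)‖ ≤ c_X (1+|t|)^{q_X}`, `‖Y(t)‖ ≤ c_Y (1+|t|)^{q_Y}`
and `q_X + q_Y − 2 ≤ q₀ < −1`, then `t ↦ X(t)Y(t)/(s(1−s))` is integrable and
`‖∫ X Y/(s(1−s)) dt‖ ≤ 12 c_X c_Y ∫ (1+|t|)^{q₀} dt`. [cite: BettinConreyFarmer2013, §3, proof of Thm. 1 ("all the other terms in (tt) are trivially O(log⁻² N)")] -/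
theorem minor_term (S : Setting) {X Y : ℝ → ℂ} (hX : Continuous X) (hY : Continuous Y)
    {cX cY qX qY q₀ : ℝ} (hcX : 0 ≤ cX) (hcY : 0 ≤ cY)
    (hbX : ∀ t : ℝ, ‖X t‖ ≤ cX * (1 + |t|) ^ qX) (hbY : ∀ t : ℝ, ‖Y t‖ ≤ cY * (1 + |t|) ^ qY)
    (hq : qX + qY - 2 ≤ q₀) (hq₀ : q₀ < -1) :
    Integrable (fun t : ℝ ↦ X t * Y t /
      ((((1 / 2 + S.ε : ℝ) : ℂ) + t * I) * (1 - (((1 / 2 + S.ε : ℝ) : ℂ) + t * I)))) ∧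
    ‖∫ t : ℝ, X t * Y t /
      ((((1 / 2 + S.ε : ℝ) : ℂ) + t * I) * (1 - (((1 / 2 + S.ε : ℝ) : ℂ) + t * I)))‖ ≤
      12 * cX * cY * ∫ t : ℝ, (1 + ‖t‖) ^ q₀ := by
  have hε := S.hε; have hε16 := S.hε16
  set a : ℝ := 1 / 2 + S.ε with ha
  have hq₀' : (Module.finrank ℝ ℝ : ℝ) < -q₀ := by rw [Module.finrank_self]; norm_num; linarith
  have hint : Integrable fun t : ℝ ↦ (1 + ‖t‖) ^ q₀ := by
    have := integrable_one_add_norm (E := ℝ) (μ := volume) hq₀'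
    simpa using this
  have hden : ∀ t : ℝ, ((a : ℂ) + t * I) * (1 - ((a : ℂ) + t * I)) ≠ 0 := by
    intro t
    refine mul_ne_zero ?_ ?_
    · intro h; have := congrArg Complex.re h; simp at this; rw [ha] at this; linarith
    · intro h; have := congrArg Complex.re h; simp at this; rw [ha] at this; linarith
  have hcont : Continuous fun t : ℝ ↦ X t * Y t / (((a : ℂ) + t * I) * (1 - ((a : ℂ) + t * I))) :=
    (hX.mul hY).div (by fun_prop) hden
  have hbound : ∀ t : ℝ, ‖X t * Y t / (((a : ℂ) + t * I) * (1 - ((a : ℂ) + t * I)))‖ ≤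
      12 * cX * cY * (1 + ‖t‖) ^ q₀ := by
    intro t
    rw [Real.norm_eq_abs]
    have hu1 : 1 ≤ 1 + |t| := by linarith [abs_nonneg t]
    have hu0 : 0 < 1 + |t| := by linarith
    have h4 := inv_norm_mul_one_sub_le (x := a) (y := t) (by rw [ha]; linarith) (by rw [ha]; linarith)
    rw [norm_div, div_eq_mul_one_div, norm_mul]
    calc ‖X t‖ * ‖Y t‖ * (1 / ‖((a : ℂ) + t * I) * (1 - ((a : ℂ) + t * I))‖)
        ≤ (cX * (1 + |t|) ^ qX) * (cY * (1 + |t|) ^ qY) * (12 * (1 + |t|) ^ (-(2 : ℝ))) :=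
          mul_le_mul (mul_le_mul (hbX t) (hbY t) (norm_nonneg _) (by positivity)) h4
            (by positivity) (by positivity)
      _ = 12 * cX * cY * ((1 + |t|) ^ qX * (1 + |t|) ^ qY * (1 + |t|) ^ (-(2 : ℝ))) := by ring
      _ = 12 * cX * cY * (1 + |t|) ^ (qX + qY - 2) := by
          rw [← Real.rpow_add hu0, ← Real.rpow_add hu0]; ring_nf
      _ ≤ 12 * cX * cY * (1 + |t|) ^ q₀ :=
          mul_le_mul_of_nonneg_left (Real.rpow_le_rpow_of_exponent_le hu1 hq) (by positivity)
  have hI : Integrable fun t : ℝ ↦ X t * Y t / (((a : ℂ) + t * I) * (1 - ((a : ℂ) + t * I))) :=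
    (hint.const_mul (12 * cX * cY)).mono' hcont.aestronglyMeasurable (Eventually.of_forall hbound)
  refine ⟨hI, ?_⟩
  calc ‖∫ t : ℝ, X t * Y t / (((a : ℂ) + t * I) * (1 - ((a : ℂ) + t * I)))‖
      ≤ ∫ t : ℝ, 12 * cX * cY * (1 + ‖t‖) ^ q₀ :=
        norm_integral_le_of_norm_le (hint.const_mul _) (Eventually.of_forall hbound)
    _ = 12 * cX * cY * ∫ t : ℝ, (1 + ‖t‖) ^ q₀ := integral_const_mul _ _

end BCF

end Literature.NumberTheory.LFunctions

end

noncomputable section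

open Complex Filter Set Real MeasureTheory
open scoped Topology ComplexConjugate ENNReal

namespace Literature.NumberTheory.LFunctions

namespace BCF

/-! ## Countability of the zeros -/

/-- The non-trivial zeros form a countable set. [folklore] -/
theorem ntz_countable : (ZetaZeros.riemannZetaNontrivialZeros).Countable := by
  have h : ZetaZeros.riemannZetaNontrivialZeros ⊆
      ⋃ n : ℕ, {ρ ∈ ZetaZeros.riemannZetaNontrivialZeros | |ρ.im| ≤ n} := by
    intro ρ hρ
    obtain ⟨n, hn⟩ := exists_nat_ge |ρ.im|
    exact Set.mem_iUnion.2 ⟨n, hρ, hn⟩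
  exact (Set.countable_iUnion fun n : ℕ ↦ (ntz_finite_abs_im_le (n : ℝ)).countable).mono h

/-! ## The Cauchy kernel `1/(ε² + (γ+t)²)` -/

/-- `1/(ε² + (γ+t)²) = ε⁻² (1 + ((t+γ)/ε)²)⁻¹`. [folklore] -/
theorem inv_sq_add_sq_eq {ε : ℝ} (hε : 0 < ε) (γ t : ℝ) :
    (ε ^ 2 + (γ + t) ^ 2)⁻¹ = ε⁻¹ ^ 2 * (1 + ((t + γ) / ε) ^ 2)⁻¹ := by
  have hε0 : ε ≠ 0 := hε.ne'
  rw [inv_pow, ← mul_inv]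
  congr 1
  field_simp
  ring

/-- `t ↦ 1/(ε² + (γ+t)²)` is integrable on `ℝ`. [folklore] -/
theorem integrable_inv_sq_add_sq {ε : ℝ} (hε : 0 < ε) (γ : ℝ) :
    Integrable fun t : ℝ ↦ (ε ^ 2 + (γ + t) ^ 2)⁻¹ := by
  have h1 : Integrable fun x : ℝ ↦ (1 + (x / ε) ^ 2)⁻¹ :=
    integrable_inv_one_add_sq.comp_div hε.ne'
  have h2 : Integrable fun t : ℝ ↦ (1 + ((t + γ) / ε) ^ 2)⁻¹ := h1.comp_add_right γ
  refine (h2.const_mul (ε⁻¹ ^ 2)).congr (Eventually.of_forall fun t ↦ ?_)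
  simp only
  rw [inv_sq_add_sq_eq hε]

/-- `∫ dt/(ε² + (γ+t)²) = π/ε`. [folklore] -/
theorem integral_inv_sq_add_sq {ε : ℝ} (hε : 0 < ε) (γ : ℝ) :
    ∫ t : ℝ, (ε ^ 2 + (γ + t) ^ 2)⁻¹ = π / ε := by
  simp_rw [inv_sq_add_sq_eq hε γ]
  rw [integral_const_mul]
  have h1 : ∫ t : ℝ, (1 + ((t + γ) / ε) ^ 2)⁻¹ = ∫ t : ℝ, (1 + (t / ε) ^ 2)⁻¹ :=
    integral_add_right_eq_self (fun t : ℝ ↦ (1 + (t / ε) ^ 2)⁻¹) γ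
  have h2 : ∫ t : ℝ, (1 + (t / ε) ^ 2)⁻¹ = |ε| • ∫ t : ℝ, (1 + t ^ 2)⁻¹ :=
    Measure.integral_comp_div (fun t : ℝ ↦ (1 + t ^ 2)⁻¹) ε
  rw [h1, h2, integral_univ_inv_one_add_sq, abs_of_pos hε, smul_eq_mul]
  have hε0 : ε ≠ 0 := hε.ne'
  field_simp

/-! ## The kernel against the weight `(1+|t|)^p` -/

/-- **Pointwise splitting.** For a zero `ρ = 1/2 + iγ` (RH), `p ≤ 0` and all real `t`:
`(1+|t|)^p/(ε²+(γ+t)²) ≤ (16/|ρ|²)(1+|t|)^p + 2^{−p}|ρ|^p/(ε²+(γ+t)²)` (far from `−γ` the kernel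
is `≤ 16/|ρ|²`; near `−γ` one has `1+|t| ≥ |ρ|/2`). [folklore] -/
theorem kernel_pointwise (hRH : RiemannHypothesis) {ρ : ℂ}
    (hρ : ρ ∈ ZetaZeros.riemannZetaNontrivialZeros) (ε : ℝ) {p : ℝ} (hp : p ≤ 0) (t : ℝ) :
    (1 + |t|) ^ p * (ε ^ 2 + (ρ.im + t) ^ 2)⁻¹ ≤
      16 / ‖ρ‖ ^ 2 * (1 + |t|) ^ p + (2 : ℝ) ^ (-p) * ‖ρ‖ ^ p * (ε ^ 2 + (ρ.im + t) ^ 2)⁻¹ := by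
  have hn : 1 / 2 ≤ ‖ρ‖ := ntz_half_le_norm hRH hρ
  have hn0 : 0 < ‖ρ‖ := by linarith
  have hγ : ‖ρ‖ ≤ |ρ.im| + 1 / 2 := ntz_norm_le hRH hρ
  have hu0 : 0 < 1 + |t| := by positivity
  have hA : 0 ≤ 16 / ‖ρ‖ ^ 2 * (1 + |t|) ^ p := by positivity
  have hB : 0 ≤ (2 : ℝ) ^ (-p) * ‖ρ‖ ^ p * (ε ^ 2 + (ρ.im + t) ^ 2)⁻¹ := by positivity
  rcases le_or_gt (‖ρ‖ / 4) |ρ.im + t| with h | h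
  · -- far from `−γ`: the kernel is `≤ 16/‖ρ‖²`
    have h1 : (ε ^ 2 + (ρ.im + t) ^ 2)⁻¹ ≤ 16 / ‖ρ‖ ^ 2 := by
      rw [← inv_div]
      refine inv_anti₀ (by positivity) ?_
      have hsq : (‖ρ‖ / 4) ^ 2 ≤ (ρ.im + t) ^ 2 := by
        rw [← sq_abs (ρ.im + t)]
        exact pow_le_pow_left₀ (by positivity) h 2
      nlinarith [sq_nonneg ε]
    calc (1 + |t|) ^ p * (ε ^ 2 + (ρ.im + t) ^ 2)⁻¹ ≤ (1 + |t|) ^ p * (16 / ‖ρ‖ ^ 2) :=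
          mul_le_mul_of_nonneg_left h1 (by positivity)
      _ = 16 / ‖ρ‖ ^ 2 * (1 + |t|) ^ p := by ring
      _ ≤ _ := le_add_of_nonneg_right hB
  · -- near `−γ`: `1 + |t| ≥ ‖ρ‖/2`
    have ht : ‖ρ‖ / 2 ≤ 1 + |t| := by
      have h3 : |ρ.im| ≤ |ρ.im + t| + |t| := by
        calc |ρ.im| = |(ρ.im + t) + (-t)| := by ring_nf
          _ ≤ |ρ.im + t| + |-t| := abs_add_le _ _
          _ = |ρ.im + t| + |t| := by rw [abs_neg]
      linarith
    have h1 : (1 + |t|) ^ p ≤ (‖ρ‖ / 2) ^ p := Real.rpow_le_rpow_of_nonpos (by positivity) ht hp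
    have h2 : (‖ρ‖ / 2) ^ p = (2 : ℝ) ^ (-p) * ‖ρ‖ ^ p := by
      rw [Real.div_rpow hn0.le (by norm_num), Real.rpow_neg (by norm_num)]; ring
    calc (1 + |t|) ^ p * (ε ^ 2 + (ρ.im + t) ^ 2)⁻¹
        ≤ (‖ρ‖ / 2) ^ p * (ε ^ 2 + (ρ.im + t) ^ 2)⁻¹ :=
          mul_le_mul_of_nonneg_right h1 (by positivity)
      _ = (2 : ℝ) ^ (-p) * ‖ρ‖ ^ p * (ε ^ 2 + (ρ.im + t) ^ 2)⁻¹ := by rw [h2]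
      _ ≤ _ := le_add_of_nonneg_left hA

/-- `t ↦ (1+|t|)^p` is integrable for `p < −1`. [folklore] -/
theorem integrable_one_add_abs_rpow {p : ℝ} (hp : p < -1) :
    Integrable fun t : ℝ ↦ (1 + |t|) ^ p := by
  have h := integrable_one_add_norm (E := ℝ) (μ := volume) (r := -p)
    (by rw [Module.finrank_self]; push_cast; linarith)
  simpa using h

/-- **One zero's contribution.** For a zero `ρ` (RH), `ε > 0` and `p < −1`:
`∫ (1+|t|)^p dt/(ε²+(γ+t)²) ≤ (16/|ρ|²) ∫(1+|t|)^p dt + 2^{−p} |ρ|^p π/ε` (as a Lebesgue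
integral). [folklore] -/
theorem lintegral_kernel_le (hRH : RiemannHypothesis) {ρ : ℂ}
    (hρ : ρ ∈ ZetaZeros.riemannZetaNontrivialZeros) {ε : ℝ} (hε : 0 < ε) {p : ℝ} (hp : p < -1) :
    ∫⁻ t : ℝ, ENNReal.ofReal ((1 + |t|) ^ p * (ε ^ 2 + (ρ.im + t) ^ 2)⁻¹) ≤
      ENNReal.ofReal (16 / ‖ρ‖ ^ 2 * (∫ t : ℝ, (1 + |t|) ^ p) +
        (2 : ℝ) ^ (-p) * ‖ρ‖ ^ p * (π / ε)) := by
  have hint1 := integrable_one_add_abs_rpow hp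
  have hint2 := integrable_inv_sq_add_sq hε ρ.im
  have hb : Integrable fun t : ℝ ↦ 16 / ‖ρ‖ ^ 2 * (1 + |t|) ^ p +
      (2 : ℝ) ^ (-p) * ‖ρ‖ ^ p * (ε ^ 2 + (ρ.im + t) ^ 2)⁻¹ :=
    (hint1.const_mul _).add (hint2.const_mul _)
  calc ∫⁻ t : ℝ, ENNReal.ofReal ((1 + |t|) ^ p * (ε ^ 2 + (ρ.im + t) ^ 2)⁻¹)
      ≤ ∫⁻ t : ℝ, ENNReal.ofReal (16 / ‖ρ‖ ^ 2 * (1 + |t|) ^ p +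
          (2 : ℝ) ^ (-p) * ‖ρ‖ ^ p * (ε ^ 2 + (ρ.im + t) ^ 2)⁻¹) :=
        lintegral_mono fun t ↦ ENNReal.ofReal_le_ofReal (kernel_pointwise hRH hρ ε (by linarith) t)
    _ = ENNReal.ofReal (∫ t : ℝ, (16 / ‖ρ‖ ^ 2 * (1 + |t|) ^ p +
          (2 : ℝ) ^ (-p) * ‖ρ‖ ^ p * (ε ^ 2 + (ρ.im + t) ^ 2)⁻¹)) :=
        (ofReal_integral_eq_lintegral_ofReal hb
          (Eventually.of_forall fun t ↦ by simp only [Pi.zero_apply]; positivity)).symm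
    _ = _ := by
        rw [integral_add (hint1.const_mul _) (hint2.const_mul _), integral_const_mul,
          integral_const_mul, integral_inv_sq_add_sq hε]

/-! ## The cross term `A₂B₂` -/

/-- **The `A₂B₂` cross term is integrable with bounded integral.** Under the standing hypotheses
there is `K` such that for all `N ≥ 2`, with `s = 1/2 + ε + it`,
`t ↦ A₂(s)A₂(1−s)/(s(1−s))` is integrable on `ℝ` and `‖∫ A₂(s)A₂(1−s)/(s(1−s)) dt‖ ≤ K`
(`A₂ = ζ·Z_N`; the factor `N^{−ε}` of `Z_N(s)` cancels the `N^{ε}` of `Z_N(1−s)`).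
[cite: BettinConreyFarmer2013, §3, proof of Thm. 1 ("all the other terms in (tt) are trivially O(log⁻² N)")] -/
theorem exists_A2B2 (S : Setting) : ∃ K : ℝ, ∀ N : ℕ, 2 ≤ N →
    Integrable (fun t : ℝ ↦ fA2 N (((1 / 2 + S.ε : ℝ) : ℂ) + t * I) *
      fA2 N (1 - (((1 / 2 + S.ε : ℝ) : ℂ) + t * I)) /
      ((((1 / 2 + S.ε : ℝ) : ℂ) + t * I) * (1 - (((1 / 2 + S.ε : ℝ) : ℂ) + t * I)))) ∧
    ‖∫ t : ℝ, fA2 N (((1 / 2 + S.ε : ℝ) : ℂ) + t * I) *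
      fA2 N (1 - (((1 / 2 + S.ε : ℝ) : ℂ) + t * I)) /
      ((((1 / 2 + S.ε : ℝ) : ℂ) + t * I) * (1 - (((1 / 2 + S.ε : ℝ) : ℂ) + t * I)))‖ ≤ K := by
  classical
  haveI : Countable ZetaZeros.riemannZetaNontrivialZeros := ntz_countable.to_subtype
  have hε := S.hε; have hε16 := S.hε16; have hδ := S.hδ; have hδ1 := S.hδ1; have hεδ := S.hεδ
  have hε0 : S.ε ≠ 0 := hε.ne'
  obtain ⟨c, hc0, hc⟩ := exists_factor_bounds S
  obtain ⟨K₃, hK₃0, hK₃⟩ := exists_lemma3 S.hRH S.hsimp hδ hδ1 S.hC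
  set a : ℝ := 1 / 2 + S.ε with ha
  set p : ℝ := 4 * S.ε - 5 / 4 - S.δ / 4 with hp
  have hp1 : p < -1 := by rw [hp]; linarith
  have hp0 : p ≤ 0 := by linarith
  -- the summable majorant
  set Ip : ℝ := ∫ t : ℝ, (1 + |t|) ^ p with hIp
  have hIp0 : 0 ≤ Ip := integral_nonneg fun t ↦ by positivity
  set J : ZetaZeros.riemannZetaNontrivialZeros → ℝ := fun ρ ↦
    ‖deriv riemannZeta ρ‖⁻¹ * (16 / ‖(ρ : ℂ)‖ ^ 2 * Ip +
      (2 : ℝ) ^ (-p) * ‖(ρ : ℂ)‖ ^ p * (π / S.ε)) with hJ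
  have hJ0 : ∀ ρ, 0 ≤ J ρ := fun ρ ↦ by
    show 0 ≤ ‖deriv riemannZeta ρ‖⁻¹ * (16 / ‖(ρ : ℂ)‖ ^ 2 * Ip +
      (2 : ℝ) ^ (-p) * ‖(ρ : ℂ)‖ ^ p * (π / S.ε))
    positivity
  have hJsum : Summable J := by
    have h1 := summable_inv_deriv_mul_norm_sq S.hRH hδ S.hC
    have h2 := summable_inv_deriv_mul_norm_rpow S.hRH hδ S.hC (α := -p) (by linarith)
      (by rw [hp]; linarith)
    refine ((h1.mul_left (16 * Ip)).add (h2.mul_left ((2 : ℝ) ^ (-p) * (π / S.ε)))).congr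
      fun ρ ↦ ?_
    have hd : ‖deriv riemannZeta ρ‖ ≠ 0 := norm_ne_zero_iff.2 (ntz_deriv_ne_zero S.hsimp ρ.2)
    have hn0 : 0 < ‖(ρ : ℂ)‖ := lt_of_lt_of_le (by norm_num) (ntz_half_le_norm S.hRH ρ.2)
    have hn0' : ‖(ρ : ℂ)‖ ≠ 0 := hn0.ne'
    have hnp : ‖(ρ : ℂ)‖ ^ p ≠ 0 := (Real.rpow_pos_of_pos hn0 _).ne'
    show _ = ‖deriv riemannZeta ρ‖⁻¹ * (16 / ‖(ρ : ℂ)‖ ^ 2 * Ip +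
      (2 : ℝ) ^ (-p) * ‖(ρ : ℂ)‖ ^ p * (π / S.ε))
    rw [Real.rpow_neg hn0.le]
    field_simp
  refine ⟨12 * c ^ 2 * ∑' ρ, J ρ, fun N hN ↦ ?_⟩
  have hN0 : (0 : ℝ) < N := by exact_mod_cast (by omega : 0 < N)
  set H : ℝ → ℂ := fun t ↦ fA2 N ((a : ℂ) + t * I) * fA2 N (1 - ((a : ℂ) + t * I)) /
    (((a : ℂ) + t * I) * (1 - ((a : ℂ) + t * I))) with hH
  -- the kernel, zero by zero
  set g : ZetaZeros.riemannZetaNontrivialZeros → ℝ → ℝ := fun ρ t ↦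
    (1 + |t|) ^ p * (‖deriv riemannZeta ρ‖⁻¹ * (S.ε ^ 2 + ((ρ : ℂ).im + t) ^ 2)⁻¹) with hg
  have hg0 : ∀ ρ t, 0 ≤ g ρ t := fun ρ t ↦ by
    show 0 ≤ (1 + |t|) ^ p * (‖deriv riemannZeta ρ‖⁻¹ * (S.ε ^ 2 + ((ρ : ℂ).im + t) ^ 2)⁻¹)
    positivity
  -- pointwise: `‖H(t)‖ ≤ 12 c² ∑_ρ g_ρ(t)`
  have key : ∀ t : ℝ, Summable (fun ρ ↦ g ρ t) ∧ ‖H t‖ ≤ 12 * c ^ 2 * ∑' ρ, g ρ t := by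
    intro t
    obtain ⟨-, -, -, -, h5, -, -, h8⟩ := hc N hN t
    have h12 := inv_norm_mul_one_sub_le (x := a) (y := t) (by rw [ha]; linarith)
      (by rw [ha]; linarith)
    set s : ℂ := (a : ℂ) + t * I with hs
    have h1re : (1 - s).re = 1 - a := by simp [hs]
    have h1im : (1 - s).im = -t := by simp [hs]
    set u : ℝ := 1 + |t| with hu
    have hu0 : 0 < u := by positivity
    -- the family at `1 - s`
    set f : ℂ → ℝ := fun ρ ↦ 1 / (‖deriv riemannZeta ρ‖ * ‖ρ - (1 - s)‖ ^ 2) with hf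
    have hf0 : ∀ ρ, 0 ≤ f ρ := fun ρ ↦ by
      show 0 ≤ 1 / (‖deriv riemannZeta ρ‖ * ‖ρ - (1 - s)‖ ^ 2); positivity
    have hB : ∀ F : Finset ℂ, (∀ ρ ∈ F, ρ ∈ ZetaZeros.riemannZetaNontrivialZeros) →
        ∑ ρ ∈ F, f ρ ≤ K₃ * S.ε⁻¹ ^ 2 * u ^ (3 / 4 - S.δ / 4) := by
      intro F hF
      have h := hK₃ S.ε hε (by linarith) (1 - s)
        (by rw [h1re, ha, show (1 - (1 / 2 + S.ε) - 1 / 2 : ℝ) = -S.ε by ring, abs_neg,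
          abs_of_pos hε])
        (by rw [h1re, ha, show (1 - (1 / 2 + S.ε) - 1 / 2 : ℝ) = -S.ε by ring, abs_neg,
          abs_of_pos hε]; linarith)
        F hF
      rwa [h1im, abs_neg] at h
    have hpart : ∀ v : Finset ZetaZeros.riemannZetaNontrivialZeros,
        ∑ x ∈ v, f x ≤ K₃ * S.ε⁻¹ ^ 2 * u ^ (3 / 4 - S.δ / 4) := by
      intro v
      have hsumF : ∑ x ∈ v, f (x : ℂ) = ∑ ρ ∈ v.map (Function.Embedding.subtype _), f ρ := by
        rw [Finset.sum_map]; rfl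
      rw [hsumF]
      refine hB _ fun ρ hρ ↦ ?_
      rw [Finset.mem_map] at hρ
      obtain ⟨x, -, rfl⟩ := hρ
      exact x.2
    have hsum : Summable fun ρ : ZetaZeros.riemannZetaNontrivialZeros ↦ f ρ :=
      summable_of_sum_le (fun ρ ↦ hf0 ρ) hpart
    -- `‖Z_N(1 - s)‖ ≤ N^ε ∑_ρ f ρ`
    have hZ : ‖zeroSum N (1 - s)‖ ≤
        (N : ℝ) ^ S.ε * ∑' ρ : ZetaZeros.riemannZetaNontrivialZeros, f ρ := by
      have h := norm_zeroSum_le S.hRH hN hsum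
      rwa [h1re, ha, show (1 / 2 - (1 - (1 / 2 + S.ε)) : ℝ) = S.ε by ring] at h
    -- identify `f` with the kernel
    have hfg : ∀ ρ : ZetaZeros.riemannZetaNontrivialZeros,
        f ρ = ‖deriv riemannZeta ρ‖⁻¹ * (S.ε ^ 2 + ((ρ : ℂ).im + t) ^ 2)⁻¹ := by
      intro ρ
      have hρre := ntz_re S.hRH ρ.2
      have h1 : ((ρ : ℂ) - (1 - s)).re = S.ε := by
        rw [Complex.sub_re, h1re, hρre, ha]; ring
      have h2 : ((ρ : ℂ) - (1 - s)).im = (ρ : ℂ).im + t := by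
        rw [Complex.sub_im, h1im]; ring
      have h3 : ‖(ρ : ℂ) - (1 - s)‖ ^ 2 = S.ε ^ 2 + ((ρ : ℂ).im + t) ^ 2 := by
        rw [← Complex.normSq_eq_norm_sq, Complex.normSq_apply, h1, h2]; ring
      show 1 / (‖deriv riemannZeta ρ‖ * ‖(ρ : ℂ) - (1 - s)‖ ^ 2) = _
      rw [h3, one_div, mul_inv]
    have hsumg : Summable fun ρ ↦ g ρ t :=
      ((hsum.congr hfg).mul_left (u ^ p)).congr fun ρ ↦ rfl
    have htsum : ∑' ρ, g ρ t = u ^ p * ∑' ρ : ZetaZeros.riemannZetaNontrivialZeros, f ρ := by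
      rw [← tsum_mul_left]; exact tsum_congr fun ρ ↦ by rw [hfg]
    refine ⟨hsumg, ?_⟩
    have hNN : (N : ℝ) ^ (-S.ε) * (N : ℝ) ^ S.ε = 1 := by
      rw [← Real.rpow_add hN0, neg_add_cancel, Real.rpow_zero]
    have hupow : u ^ (2 * S.ε + 3 / 4 - S.δ / 4) * u ^ (2 * S.ε) * u ^ (-(2 : ℝ)) = u ^ p := by
      rw [← Real.rpow_add hu0, ← Real.rpow_add hu0]; congr 1; rw [hp]; ring
    show ‖fA2 N s * fA2 N (1 - s) / (s * (1 - s))‖ ≤ 12 * c ^ 2 * ∑' ρ, g ρ t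
    rw [htsum, norm_div, div_eq_mul_one_div, norm_mul (fA2 N s),
      show fA2 N (1 - s) = riemannZeta (1 - s) * zeroSum N (1 - s) from rfl,
      norm_mul (riemannZeta (1 - s))]
    set T : ℝ := ∑' ρ : ZetaZeros.riemannZetaNontrivialZeros, f ρ with hT
    have hT0 : 0 ≤ T := tsum_nonneg fun ρ ↦ hf0 ρ
    calc ‖fA2 N s‖ * (‖riemannZeta (1 - s)‖ * ‖zeroSum N (1 - s)‖) * (1 / ‖s * (1 - s)‖)
        ≤ (c * (N : ℝ) ^ (-S.ε) * u ^ (2 * S.ε + 3 / 4 - S.δ / 4)) *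
            ((c * u ^ (2 * S.ε)) * ((N : ℝ) ^ S.ε * T)) * (12 * u ^ (-(2 : ℝ))) := by
          have hBC : ‖riemannZeta (1 - s)‖ * ‖zeroSum N (1 - s)‖ ≤
              (c * u ^ (2 * S.ε)) * ((N : ℝ) ^ S.ε * T) :=
            mul_le_mul h8 hZ (norm_nonneg _) (by positivity)
          exact mul_le_mul (mul_le_mul h5 hBC (by positivity) (by positivity)) h12
            (by positivity) (by positivity)
      _ = 12 * c ^ 2 * (((N : ℝ) ^ (-S.ε) * (N : ℝ) ^ S.ε) *
            (u ^ (2 * S.ε + 3 / 4 - S.δ / 4) * u ^ (2 * S.ε) * u ^ (-(2 : ℝ)))) * T := by ring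
      _ = 12 * c ^ 2 * (u ^ p * T) := by rw [hNN, hupow]; ring
  -- continuity of the integrand
  have hcont : Continuous H := by
    have hA := (continuous_factors S hN (x := a) (by rw [ha]; linarith) (by rw [ha]; linarith)
      (by rw [ha]; intro h; linarith)).2.1
    have hB' := (continuous_factors S hN (x := 1 - a) (by rw [ha]; linarith)
      (by rw [ha]; linarith) (by rw [ha]; intro h; linarith)).2.1
    have hB : Continuous fun t : ℝ ↦ fA2 N (1 - ((a : ℂ) + t * I)) := by
      have : (fun t : ℝ ↦ fA2 N (1 - ((a : ℂ) + t * I))) =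
          (fun t : ℝ ↦ fA2 N (((1 - a : ℝ) : ℂ) + t * I)) ∘ fun t : ℝ ↦ -t := by
        ext t; simp only [Function.comp_apply]; congr 1; push_cast; ring
      rw [this]; exact hB'.comp continuous_neg
    have hden : ∀ t : ℝ, ((a : ℂ) + t * I) * (1 - ((a : ℂ) + t * I)) ≠ 0 := by
      intro t
      refine mul_ne_zero ?_ ?_
      · intro h; have := congrArg Complex.re h; simp at this; rw [ha] at this; linarith
      · intro h; have := congrArg Complex.re h; simp at this; rw [ha] at this; linarith
    exact (hA.mul hB).div (by fun_prop) hden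
  -- measurability of the kernels
  have hgc : ∀ ρ : ZetaZeros.riemannZetaNontrivialZeros, Continuous (g ρ) := fun ρ ↦ by
    show Continuous fun t : ℝ ↦
      (1 + |t|) ^ p * (‖deriv riemannZeta ρ‖⁻¹ * (S.ε ^ 2 + ((ρ : ℂ).im + t) ^ 2)⁻¹)
    exact (Continuous.rpow_const (by fun_prop) fun t ↦ Or.inl (by positivity)).mul
      (continuous_const.mul (Continuous.inv₀ (by fun_prop) fun t ↦ by positivity))
  have hgm : ∀ ρ : ZetaZeros.riemannZetaNontrivialZeros,
      AEMeasurable fun t ↦ ENNReal.ofReal (g ρ t) := fun ρ ↦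
    (hgc ρ).measurable.ennreal_ofReal.aemeasurable
  -- one zero's contribution
  have hJρ : ∀ ρ : ZetaZeros.riemannZetaNontrivialZeros,
      ∫⁻ t, ENNReal.ofReal (g ρ t) ≤ ENNReal.ofReal (J ρ) := by
    intro ρ
    have hk := lintegral_kernel_le S.hRH ρ.2 hε hp1 (ρ := (ρ : ℂ))
    calc ∫⁻ t, ENNReal.ofReal (g ρ t)
        = ∫⁻ t, ENNReal.ofReal ‖deriv riemannZeta ρ‖⁻¹ *
            ENNReal.ofReal ((1 + |t|) ^ p * (S.ε ^ 2 + ((ρ : ℂ).im + t) ^ 2)⁻¹) := by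
          refine lintegral_congr fun t ↦ ?_
          rw [← ENNReal.ofReal_mul (by positivity)]
          congr 1
          show (1 + |t|) ^ p * (‖deriv riemannZeta ρ‖⁻¹ * (S.ε ^ 2 + ((ρ : ℂ).im + t) ^ 2)⁻¹) = _
          ring
      _ = ENNReal.ofReal ‖deriv riemannZeta ρ‖⁻¹ *
            ∫⁻ t, ENNReal.ofReal ((1 + |t|) ^ p * (S.ε ^ 2 + ((ρ : ℂ).im + t) ^ 2)⁻¹) :=
          lintegral_const_mul' _ _ ENNReal.ofReal_ne_top
      _ ≤ ENNReal.ofReal ‖deriv riemannZeta ρ‖⁻¹ *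
            ENNReal.ofReal (16 / ‖(ρ : ℂ)‖ ^ 2 * Ip + (2 : ℝ) ^ (-p) * ‖(ρ : ℂ)‖ ^ p * (π / S.ε)) :=
          mul_le_mul' le_rfl hk
      _ = ENNReal.ofReal (J ρ) := by rw [← ENNReal.ofReal_mul (by positivity)]
  -- Tonelli
  have hnorm_le : ∀ t, ENNReal.ofReal ‖H t‖ ≤
      ENNReal.ofReal (12 * c ^ 2) * ∑' ρ, ENNReal.ofReal (g ρ t) := by
    intro t
    obtain ⟨hs, hb⟩ := key t
    rw [← ENNReal.ofReal_tsum_of_nonneg (fun ρ ↦ hg0 ρ t) hs, ← ENNReal.ofReal_mul (by positivity)]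
    exact ENNReal.ofReal_le_ofReal hb
  have hlin : ∫⁻ t, ENNReal.ofReal ‖H t‖ ≤ ENNReal.ofReal (12 * c ^ 2 * ∑' ρ, J ρ) := by
    calc ∫⁻ t, ENNReal.ofReal ‖H t‖
        ≤ ∫⁻ t, ENNReal.ofReal (12 * c ^ 2) * ∑' ρ, ENNReal.ofReal (g ρ t) :=
          lintegral_mono fun t ↦ hnorm_le t
      _ = ENNReal.ofReal (12 * c ^ 2) * ∑' ρ, ∫⁻ t, ENNReal.ofReal (g ρ t) := by
          rw [lintegral_const_mul' _ _ ENNReal.ofReal_ne_top, lintegral_tsum hgm]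
      _ ≤ ENNReal.ofReal (12 * c ^ 2) * ∑' ρ, ENNReal.ofReal (J ρ) :=
          mul_le_mul' le_rfl (ENNReal.tsum_le_tsum hJρ)
      _ = ENNReal.ofReal (12 * c ^ 2 * ∑' ρ, J ρ) := by
          rw [← ENNReal.ofReal_tsum_of_nonneg hJ0 hJsum, ← ENNReal.ofReal_mul (by positivity)]
  refine ⟨⟨hcont.aestronglyMeasurable,
    (hasFiniteIntegral_iff_norm _).2 (hlin.trans_lt ENNReal.ofReal_lt_top)⟩, ?_⟩
  calc ‖∫ t, H t‖ ≤ (∫⁻ t, ENNReal.ofReal ‖H t‖).toReal := norm_integral_le_lintegral_norm H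
    _ ≤ (ENNReal.ofReal (12 * c ^ 2 * ∑' ρ, J ρ)).toReal :=
        ENNReal.toReal_mono ENNReal.ofReal_ne_top hlin
    _ = 12 * c ^ 2 * ∑' ρ, J ρ :=
        ENNReal.toReal_ofReal (mul_nonneg (by positivity) (tsum_nonneg hJ0))

end BCF

end Literature.NumberTheory.LFunctions

end

noncomputable section

open Complex Filter Set Real MeasureTheory Asymptotics
open scoped Topology ComplexConjugate

namespace Literature.NumberTheory.LFunctions

open Literature.Barriers.RiemannHypothesis (levinsonMollifier)
open scoped ArithmeticFunction.Moebius

namespace BCF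

/-! ## The mollifier: conjugation, size, differentiability -/

/-- `V_N(s̄) = \overline{V_N(s)}` (real coefficients). [folklore] -/
theorem levinsonMollifier_conj (N : ℕ) (s : ℂ) :
    levinsonMollifier N (conj s) = conj (levinsonMollifier N s) := by
  unfold levinsonMollifier
  rw [map_sum]
  refine Finset.sum_congr rfl fun n hn ↦ ?_
  simp only [map_mul, map_intCast, Complex.conj_ofReal]
  congr 1
  rw [← map_neg, cpow_conj _ _ (by rw [Complex.natCast_arg]; exact Real.pi_pos.ne), Complex.conj_natCast]

/-- `f(s̄) = \overline{f(s)}` for `f = 1 − ζV_N`. [folklore] -/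
theorem one_sub_zeta_mul_conj (N : ℕ) (s : ℂ) :
    1 - riemannZeta (conj s) * levinsonMollifier N (conj s) =
      conj (1 - riemannZeta s * levinsonMollifier N s) := by
  rw [riemannZeta_conj, levinsonMollifier_conj, map_sub, map_one, map_mul]

/-- `‖V_N(s)‖ ≤ N` for `Re s ≥ 0` (`N ≥ 2`; each coefficient has modulus `≤ 1`). [folklore] -/
theorem norm_levinsonMollifier_le {N : ℕ} (hN : 2 ≤ N) {s : ℂ} (hs : 0 ≤ s.re) :
    ‖levinsonMollifier N s‖ ≤ N := by
  unfold levinsonMollifier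
  refine (norm_sum_le _ _).trans ?_
  have hL : 0 < Real.log N := Real.log_pos (by exact_mod_cast hN)
  have hterm : ∀ n ∈ Finset.Icc 1 N,
      ‖((μ n : ℤ) : ℂ) * ((1 - Real.log n / Real.log N : ℝ) : ℂ) * (n : ℂ) ^ (-s)‖ ≤ 1 := by
    intro n hn
    obtain ⟨hn1, hnN⟩ := Finset.mem_Icc.1 hn
    have hn0 : (0 : ℝ) < n := by exact_mod_cast hn1
    rw [norm_mul, norm_mul]
    have h1 : ‖((μ n : ℤ) : ℂ)‖ ≤ 1 := by
      rw [Complex.norm_intCast]; exact_mod_cast ArithmeticFunction.abs_moebius_le_one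
    have h2 : ‖((1 - Real.log n / Real.log N : ℝ) : ℂ)‖ ≤ 1 := by
      rw [Complex.norm_real, Real.norm_eq_abs, abs_le]
      have hlogn : 0 ≤ Real.log n := Real.log_nonneg (by exact_mod_cast hn1)
      have hlogle : Real.log n ≤ Real.log N := Real.log_le_log hn0 (by exact_mod_cast hnN)
      have h3 : Real.log n / Real.log N ≤ 1 := (div_le_one hL).2 hlogle
      have h4 : 0 ≤ Real.log n / Real.log N := div_nonneg hlogn hL.le
      constructor <;> linarith
    have h3 : ‖(n : ℂ) ^ (-s)‖ ≤ 1 := by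
      rw [norm_natCast_cpow_of_pos (by omega), Complex.neg_re]
      exact Real.rpow_le_one_of_one_le_of_nonpos (by exact_mod_cast hn1) (by linarith)
    calc ‖((μ n : ℤ) : ℂ)‖ * ‖((1 - Real.log n / Real.log N : ℝ) : ℂ)‖ * ‖(n : ℂ) ^ (-s)‖
        ≤ 1 * 1 * 1 := by gcongr
      _ = 1 := by norm_num
  calc ∑ n ∈ Finset.Icc 1 N, ‖((μ n : ℤ) : ℂ) * ((1 - Real.log n / Real.log N : ℝ) : ℂ) * (n : ℂ) ^ (-s)‖
      ≤ ∑ n ∈ Finset.Icc 1 N, (1 : ℝ) := Finset.sum_le_sum hterm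
    _ = N := by simp

/-- `V_N` is entire. [folklore] -/
theorem differentiable_levinsonMollifier (N : ℕ) : Differentiable ℂ (levinsonMollifier N) := by
  have : levinsonMollifier N = fun s : ℂ ↦ ∑ n ∈ Finset.Icc 1 N,
      ((μ n : ℤ) : ℂ) * ((1 - Real.log n / Real.log N : ℝ) : ℂ) * (n : ℂ) ^ (-s) := by
    ext s; rfl
  rw [this]
  refine Differentiable.fun_sum fun n hn ↦ ?_
  have hn1 : 1 ≤ n := (Finset.mem_Icc.1 hn).1
  exact (differentiable_const _).mul
    (differentiable_id.neg.const_cpow (Or.inl (by exact_mod_cast (by omega : n ≠ 0))))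

/-- `F_N(w) = f(w)f(1−w)/(w(1−w))` is differentiable at every `w ≠ 0, 1`. [folklore] -/
theorem differentiableAt_FN (N : ℕ) {w : ℂ} (hw0 : w ≠ 0) (hw1 : w ≠ 1) :
    DifferentiableAt ℂ (fun w : ℂ ↦ (1 - riemannZeta w * levinsonMollifier N w) *
      (1 - riemannZeta (1 - w) * levinsonMollifier N (1 - w)) / (w * (1 - w))) w := by
  have hV := differentiable_levinsonMollifier N
  have h1 : DifferentiableAt ℂ (fun w ↦ 1 - riemannZeta w * levinsonMollifier N w) w :=
    (differentiableAt_const _).sub ((differentiableAt_riemannZeta hw1).mul (hV w))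
  have hsub : DifferentiableAt ℂ (fun w : ℂ ↦ 1 - w) w := (differentiableAt_const _).sub differentiableAt_id
  have h1w : 1 - w ≠ 1 := fun h ↦ hw0 (sub_eq_self.1 h)
  have hz : DifferentiableAt ℂ (fun w ↦ riemannZeta (1 - w)) w :=
    (differentiableAt_riemannZeta h1w).comp w hsub
  have hv : DifferentiableAt ℂ (fun w ↦ levinsonMollifier N (1 - w)) w := (hV (1 - w)).comp w hsub
  have h2 : DifferentiableAt ℂ (fun w ↦ 1 - riemannZeta (1 - w) * levinsonMollifier N (1 - w)) w :=
    (differentiableAt_const _).sub (hz.mul hv)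
  have hden : DifferentiableAt ℂ (fun w : ℂ ↦ w * (1 - w)) w := differentiableAt_id.mul hsub
  exact (h1.mul h2).div hden (mul_ne_zero hw0 (sub_ne_zero.2 (Ne.symm hw1)))

/-! ## Step 1: the critical line -/

/-- **On the critical line the integrand is `|f|²/(1/4+t²)`**: with `s = 1/2 + it`, `1 − s = s̄`,
`f(s̄) = \overline{f(s)}` and `s s̄ = 1/4 + t²`. [cite: BettinConreyFarmer2013, §3, first display of the proof of Thm. 1] -/
theorem criticalLine_identity (N : ℕ) (t : ℝ) :
    (1 - riemannZeta (1 / 2 + t * I) * levinsonMollifier N (1 / 2 + t * I)) *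
      (1 - riemannZeta (1 - (1 / 2 + t * I)) * levinsonMollifier N (1 - (1 / 2 + t * I))) /
      ((1 / 2 + t * I) * (1 - (1 / 2 + t * I))) =
    ((‖1 - riemannZeta (1 / 2 + t * I) * levinsonMollifier N (1 / 2 + t * I)‖ ^ 2 /
      (1 / 4 + t ^ 2) : ℝ) : ℂ) := by
  have hconj : (1 : ℂ) - (1 / 2 + t * I) = conj (1 / 2 + t * I) := by
    refine Complex.ext ?_ ?_ <;> simp; norm_num
  rw [hconj, one_sub_zeta_mul_conj, Complex.mul_conj, Complex.mul_conj]
  have hn : Complex.normSq (1 / 2 + t * I) = 1 / 4 + t ^ 2 := by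
    rw [Complex.normSq_apply]; simp; ring
  rw [hn, Complex.normSq_eq_norm_sq]
  push_cast
  ring

/-- **`bcfDistSq N = (1/2π) ∫_{(1/2)} f(s)f(1−s)/(s(1−s)) |ds|`.** [cite: BettinConreyFarmer2013, §3, first display of the proof of Thm. 1] -/
theorem bcfDistSq_eq_integral (N : ℕ) : (bcfDistSq N : ℂ) = 1 / (2 * π) *
    ∫ t : ℝ, (1 - riemannZeta (1 / 2 + t * I) * levinsonMollifier N (1 / 2 + t * I)) *
      (1 - riemannZeta (1 - (1 / 2 + t * I)) * levinsonMollifier N (1 - (1 / 2 + t * I))) /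
      ((1 / 2 + t * I) * (1 - (1 / 2 + t * I))) := by
  unfold bcfDistSq
  rw [Complex.ofReal_mul, ← integral_complex_ofReal]
  congr 1
  · push_cast; ring
  · exact integral_congr_ae (Eventually.of_forall fun t ↦ (criticalLine_identity N t).symm)

/-! ## Step 2: moving the line of integration -/

/-- **Crude bound in the strip.** For `|x − 1/2| ≤ ε` (`ε ≤ 1/16`), `N ≥ 2` and all real `t`:
`‖F_N(x+it)‖ ≤ 48 (1 + N C_ζ)² (1+|t|)^{4ε−2}`, where `C_ζ` is the constant of the Lindelöf-type
bound `|ζ| ≤ C_ζ (2+|t|)^{2ε}` in the strip. [folklore] -/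
theorem norm_FN_le (S : Setting) {Cs : ℝ} (hCs0 : 0 < Cs)
    (hCs : ∀ u : ℂ, 1 / 2 - S.ε ≤ u.re → u.re ≤ 1 / 2 + S.ε →
      ‖riemannZeta u‖ ≤ Cs * (2 + |u.im|) ^ (2 * S.ε))
    {N : ℕ} (hN : 2 ≤ N) {x : ℝ} (hx1 : 1 / 2 - S.ε ≤ x) (hx2 : x ≤ 1 / 2 + S.ε) (t : ℝ) :
    ‖(1 - riemannZeta (x + t * I) * levinsonMollifier N (x + t * I)) *
        (1 - riemannZeta (1 - (x + t * I)) * levinsonMollifier N (1 - (x + t * I))) /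
        ((x + t * I) * (1 - (x + t * I)))‖ ≤
      48 * (1 + N * Cs) ^ 2 * (1 + |t|) ^ (4 * S.ε - 2) := by
  have hε := S.hε; have hε16 := S.hε16
  have h12 := inv_norm_mul_one_sub_le (x := x) (y := t) (by linarith) (by linarith)
  set s : ℂ := (x : ℂ) + t * I with hs
  have hsre : s.re = x := by simp [hs]
  have hsim : s.im = t := by simp [hs]
  have h1re : (1 - s).re = 1 - x := by simp [hs]
  have h1im : (1 - s).im = -t := by simp [hs]
  set u : ℝ := 1 + |t| with hu
  have hu1 : 1 ≤ u := by rw [hu]; linarith [abs_nonneg t]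
  have hu0 : 0 < u := by linarith
  have hV1 : ‖levinsonMollifier N s‖ ≤ N := norm_levinsonMollifier_le hN (by rw [hsre]; linarith)
  have hV2 : ‖levinsonMollifier N (1 - s)‖ ≤ N :=
    norm_levinsonMollifier_le hN (by rw [h1re]; linarith)
  have hpow : (2 + |t|) ^ (2 * S.ε) ≤ 2 * u ^ (2 * S.ε) :=
    two_add_rpow_le t (by linarith) (by linarith)
  have hζ1 : ‖riemannZeta s‖ ≤ Cs * (2 * u ^ (2 * S.ε)) := by
    have h := hCs s (by rw [hsre]; linarith) (by rw [hsre]; linarith)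
    rw [hsim] at h
    exact h.trans (mul_le_mul_of_nonneg_left hpow hCs0.le)
  have hζ2 : ‖riemannZeta (1 - s)‖ ≤ Cs * (2 * u ^ (2 * S.ε)) := by
    have h := hCs (1 - s) (by rw [h1re]; linarith) (by rw [h1re]; linarith)
    rw [h1im, abs_neg] at h
    exact h.trans (mul_le_mul_of_nonneg_left hpow hCs0.le)
  have hone : 1 ≤ 2 * u ^ (2 * S.ε) := by
    have : 1 ≤ u ^ (2 * S.ε) := Real.one_le_rpow hu1 (by linarith)
    linarith
  have hf : ∀ w : ℂ, ‖riemannZeta w‖ ≤ Cs * (2 * u ^ (2 * S.ε)) → ‖levinsonMollifier N w‖ ≤ N →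
      ‖1 - riemannZeta w * levinsonMollifier N w‖ ≤ (1 + N * Cs) * (2 * u ^ (2 * S.ε)) := by
    intro w hz hv
    calc ‖1 - riemannZeta w * levinsonMollifier N w‖ ≤ ‖(1 : ℂ)‖ + ‖riemannZeta w * levinsonMollifier N w‖ :=
          norm_sub_le _ _
      _ = 1 + ‖riemannZeta w‖ * ‖levinsonMollifier N w‖ := by rw [norm_one, norm_mul]
      _ ≤ 1 * (2 * u ^ (2 * S.ε)) + (Cs * (2 * u ^ (2 * S.ε))) * N := by
          have := mul_le_mul hz hv (norm_nonneg _) (by positivity)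
          linarith
      _ = (1 + N * Cs) * (2 * u ^ (2 * S.ε)) := by ring
  have hf1 := hf s hζ1 hV1
  have hf2 := hf (1 - s) hζ2 hV2
  rw [norm_div, div_eq_mul_one_div, norm_mul]
  calc ‖1 - riemannZeta s * levinsonMollifier N s‖ *
        ‖1 - riemannZeta (1 - s) * levinsonMollifier N (1 - s)‖ * (1 / ‖s * (1 - s)‖)
      ≤ ((1 + N * Cs) * (2 * u ^ (2 * S.ε))) * ((1 + N * Cs) * (2 * u ^ (2 * S.ε))) *
          (12 * u ^ (-(2 : ℝ))) :=
        mul_le_mul (mul_le_mul hf1 hf2 (norm_nonneg _) (by positivity)) h12 (by positivity)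
          (by positivity)
    _ = 48 * (1 + N * Cs) ^ 2 * (u ^ (2 * S.ε) * u ^ (2 * S.ε) * u ^ (-(2 : ℝ))) := by ring
    _ = 48 * (1 + N * Cs) ^ 2 * u ^ (4 * S.ε - 2) := by
        rw [← Real.rpow_add hu0, ← Real.rpow_add hu0]; congr 1; ring_nf

/-- **"We start by moving the line of integration to `Re s = 1/2 + ε`."** The integrand
`F_N(s) = f(s)f(1−s)/(s(1−s))` is holomorphic in `0 < Re s < 1` and `≪_N (1+|t|)^{4ε−2}` for
`|Re s − 1/2| ≤ ε`, so `∫ F_N(1/2+it) dt = ∫ F_N(1/2+ε+it) dt`. [cite: BettinConreyFarmer2013, §3, proof of Thm. 1] -/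
theorem integral_shift (S : Setting) {N : ℕ} (hN : 2 ≤ N) :
    (∫ t : ℝ, (1 - riemannZeta (1 / 2 + t * I) * levinsonMollifier N (1 / 2 + t * I)) *
      (1 - riemannZeta (1 - (1 / 2 + t * I)) * levinsonMollifier N (1 - (1 / 2 + t * I))) /
      ((1 / 2 + t * I) * (1 - (1 / 2 + t * I)))) =
    ∫ t : ℝ, (1 - riemannZeta (((1 / 2 + S.ε : ℝ) : ℂ) + t * I) *
        levinsonMollifier N (((1 / 2 + S.ε : ℝ) : ℂ) + t * I)) *
      (1 - riemannZeta (1 - (((1 / 2 + S.ε : ℝ) : ℂ) + t * I)) *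
        levinsonMollifier N (1 - (((1 / 2 + S.ε : ℝ) : ℂ) + t * I))) /
      ((((1 / 2 + S.ε : ℝ) : ℂ) + t * I) * (1 - (((1 / 2 + S.ε : ℝ) : ℂ) + t * I))) := by
  have hε := S.hε; have hε16 := S.hε16
  obtain ⟨Cs, hCs0, hCs⟩ := exists_norm_zeta_le_strip S.hRH hε (by linarith)
  set F : ℂ → ℂ := fun w ↦ (1 - riemannZeta w * levinsonMollifier N w) *
    (1 - riemannZeta (1 - w) * levinsonMollifier N (1 - w)) / (w * (1 - w)) with hF
  have hbound : ∀ x : ℝ, 1 / 2 - S.ε ≤ x → x ≤ 1 / 2 + S.ε → ∀ t : ℝ,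
      ‖F (x + t * I)‖ ≤ 48 * (1 + N * Cs) ^ 2 * (1 + |t|) ^ (4 * S.ε - 2) :=
    fun x hx1 hx2 t ↦ norm_FN_le S hCs0 hCs hN hx1 hx2 t
  have hdiff : ∀ x : ℝ, 1 / 2 - S.ε ≤ x → x ≤ 1 / 2 + S.ε → ∀ t : ℝ,
      DifferentiableAt ℂ F (x + t * I) := by
    intro x hx1 hx2 t
    refine differentiableAt_FN N ?_ ?_
    · intro h; have := congrArg Complex.re h; simp at this; linarith
    · intro h; have := congrArg Complex.re h; simp at this; linarith
  have hcont : ∀ x : ℝ, 1 / 2 - S.ε ≤ x → x ≤ 1 / 2 + S.ε →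
      Continuous fun t : ℝ ↦ F (x + t * I) := by
    intro x hx1 hx2
    have hline : Continuous fun t : ℝ ↦ (x : ℂ) + t * I := by fun_prop
    exact continuous_iff_continuousAt.2 fun t ↦
      (hdiff x hx1 hx2 t).continuousAt.comp (f := fun t : ℝ ↦ (x : ℂ) + t * I) hline.continuousAt
  have hint : ∀ x : ℝ, 1 / 2 - S.ε ≤ x → x ≤ 1 / 2 + S.ε →
      Integrable fun t : ℝ ↦ F (x + t * I) := fun x hx1 hx2 ↦
    ((integrable_one_add_abs_rpow (p := 4 * S.ε - 2) (by linarith)).const_mul _).mono'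
      (hcont x hx1 hx2).aestronglyMeasurable (Eventually.of_forall (hbound x hx1 hx2))
  have h := Literature.Analysis.Complex.integral_vertical_eq_of_differentiableOn (F := F)
    (a := 1 / 2) (b := 1 / 2 + S.ε) (by linarith) ?_ (hint _ (by linarith) (by linarith))
    (hint _ (by linarith) le_rfl) ?_
  · have e : ((1 / 2 : ℝ) : ℂ) = 1 / 2 := by push_cast; ring
    rw [e] at h
    exact h
  · intro w hw
    have hw' : 1 / 2 ≤ w.re ∧ w.re ≤ 1 / 2 + S.ε := hw
    refine (differentiableAt_FN N ?_ ?_).differentiableWithinAt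
    · intro h; rw [h, Complex.zero_re] at hw'; linarith [hw'.1]
    · intro h; rw [h, Complex.one_re] at hw'; linarith [hw'.2]
  · intro η hη
    set M : ℝ := 48 * (1 + N * Cs) ^ 2 with hM
    have hM0 : 0 < M := by positivity
    refine ⟨max 1 (M / η), fun T hT x hx ↦ ?_⟩
    have hT1 : 1 ≤ |T| := le_trans (le_max_left _ _) hT
    have hT2 : M / η ≤ |T| := le_trans (le_max_right _ _) hT
    have hT0 : 0 < |T| := by linarith
    have hMle : M ≤ |T| * η := (div_le_iff₀ hη).1 hT2
    calc ‖F (x + T * I)‖ ≤ M * (1 + |T|) ^ (4 * S.ε - 2) := hbound x (by linarith [hx.1]) hx.2 T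
      _ ≤ M * (1 + |T|) ^ (-1 : ℝ) :=
          mul_le_mul_of_nonneg_left (Real.rpow_le_rpow_of_exponent_le (by linarith) (by linarith))
            hM0.le
      _ ≤ M * |T|⁻¹ := by
          rw [Real.rpow_neg_one]
          exact mul_le_mul_of_nonneg_left (inv_anti₀ hT0 (by linarith)) hM0.le
      _ ≤ η := by rw [mul_inv_le_iff₀ hT0]; linarith

/-! ## Step 3: the line `Re s = 1/2 + ε` -/

/-- Continuity of the factors at `1 − s` along the line. [folklore] -/
theorem continuous_factors_one_sub (S : Setting) {N : ℕ} (hN : 2 ≤ N) :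
    (Continuous fun t : ℝ ↦ fA1 (1 - ((((1 / 2 + S.ε : ℝ)) : ℂ) + t * I))) ∧
    (Continuous fun t : ℝ ↦ fA2 N (1 - (((1 / 2 + S.ε : ℝ) : ℂ) + t * I))) ∧
    (Continuous fun t : ℝ ↦ fA3 N (1 - (((1 / 2 + S.ε : ℝ) : ℂ) + t * I))) := by
  have hε := S.hε; have hε16 := S.hε16
  obtain ⟨h1, h2, h3⟩ := continuous_factors S hN (x := 1 - (1 / 2 + S.ε)) (by linarith)
    (by linarith) (by intro h; linarith)
  have he : ∀ g : ℂ → ℂ, (fun t : ℝ ↦ g (1 - (((1 / 2 + S.ε : ℝ) : ℂ) + t * I))) =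
      (fun t : ℝ ↦ g (((1 - (1 / 2 + S.ε) : ℝ) : ℂ) + t * I)) ∘ fun t : ℝ ↦ -t := by
    intro g; ext t; simp only [Function.comp_apply]; congr 1; push_cast; ring
  refine ⟨?_, ?_, ?_⟩
  · rw [he fA1]; exact h1.comp continuous_neg
  · rw [he (fA2 N)]; exact h2.comp continuous_neg
  · rw [he (fA3 N)]; exact h3.comp continuous_neg

/-- **The line `Re s = 1/2 + ε`: `log²N ∫ F_N = 2π log N ∑_ρ 1/(ρ(1−ρ)) + O(1)`.** There is `K`
such that for all `N ≥ 2`,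
`‖log²N · ∫ F_N(1/2+ε+it) dt − 2π log N · ∑_ρ 1/(ρ(1−ρ))‖ ≤ K` (sum over the distinct
non-trivial zeros). The nine products of `(A₁−A₂−A₃)(s)(A₁−A₂−A₃)(1−s)/(s(1−s))` are integrated
separately: `−A₁(s)A₂(1−s)/(s(1−s)) = −Ψ_N(1−s)` gives the main term (`BCF.exists_main_term`), the
others are bounded (`BCF.minor_term`, `BCF.exists_A2B2`). [cite: BettinConreyFarmer2013, §3, proof of Thm. 1, displays (tt) to the end] -/
theorem exists_line_bound (S : Setting) : ∃ K : ℝ, ∀ N : ℕ, 2 ≤ N →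
    ‖(Real.log N : ℂ) ^ 2 *
        (∫ t : ℝ, (1 - riemannZeta (((1 / 2 + S.ε : ℝ) : ℂ) + t * I) *
            levinsonMollifier N (((1 / 2 + S.ε : ℝ) : ℂ) + t * I)) *
          (1 - riemannZeta (1 - (((1 / 2 + S.ε : ℝ) : ℂ) + t * I)) *
            levinsonMollifier N (1 - (((1 / 2 + S.ε : ℝ) : ℂ) + t * I))) /
          ((((1 / 2 + S.ε : ℝ) : ℂ) + t * I) * (1 - (((1 / 2 + S.ε : ℝ) : ℂ) + t * I)))) -
      2 * π * (Real.log N : ℂ) *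
        ∑' ρ : ZetaZeros.riemannZetaNontrivialZeros, (1 : ℂ) / ((ρ : ℂ) * (1 - ρ))‖ ≤ K := by
  have hε := S.hε; have hε16 := S.hε16; have hδ := S.hδ; have hδ1 := S.hδ1; have hεδ := S.hεδ
  obtain ⟨c, hc0, hc⟩ := exists_factor_bounds S
  obtain ⟨Kz, hKz⟩ := exists_A2B2 S
  obtain ⟨R, hR⟩ := exists_main_term S.hRH S.hsimp hδ hδ1 S.hC hε hε16
  have hq₀ : (-1 - S.δ / 8 : ℝ) < -1 := by linarith
  have hq1 : (1 / 4 : ℝ) + 1 / 4 - 2 ≤ -1 - S.δ / 8 := by linarith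
  have hq2 : (2 * S.ε + 3 / 4 - S.δ / 4) + 1 / 4 - 2 ≤ -1 - S.δ / 8 := by linarith
  have hq3 : 1 / 4 + (2 * S.ε + 3 / 4 - S.δ / 4) - 2 ≤ -1 - S.δ / 8 := by linarith
  have hI₀ : 0 ≤ ∫ t : ℝ, (1 + ‖t‖) ^ (-1 - S.δ / 8 : ℝ) := integral_nonneg fun t ↦ by positivity
  refine ⟨7 * (12 * c * c * ∫ t : ℝ, (1 + ‖t‖) ^ (-1 - S.δ / 8 : ℝ)) + Kz + R, fun N hN ↦ ?_⟩
  obtain ⟨hZZi, hZZb⟩ := hKz N hN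
  obtain ⟨hMi, hMb⟩ := hR N hN
  have hN1 : (1 : ℝ) ≤ N := by exact_mod_cast (by omega : 1 ≤ N)
  have hN0 : (0 : ℝ) < N := by linarith
  -- continuity of the six factors
  obtain ⟨cA1, cA2, cA3⟩ := continuous_factors S hN (x := 1 / 2 + S.ε) (by linarith) (by linarith)
    (by intro h; linarith)
  obtain ⟨cB1, cB2, cB3⟩ := continuous_factors_one_sub S hN
  -- bounds for the six factors (weakened where convenient)
  have hNε : (N : ℝ) ^ (-S.ε) ≤ 1 := Real.rpow_le_one_of_one_le_of_nonpos hN1 (by linarith)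
  have hN4 : (N : ℝ) ^ (-(1 / 4 : ℝ)) ≤ 1 := Real.rpow_le_one_of_one_le_of_nonpos hN1 (by norm_num)
  have hN4ε : (N : ℝ) ^ (-(1 / 4 : ℝ)) * (N : ℝ) ^ S.ε ≤ 1 := by
    rw [← Real.rpow_add hN0]
    exact Real.rpow_le_one_of_one_le_of_nonpos hN1 (by linarith)
  have hA1 : ∀ t : ℝ, ‖fA1 (((1 / 2 + S.ε : ℝ) : ℂ) + t * I)‖ ≤ c * (1 + |t|) ^ (1 / 4 : ℝ) :=
    fun t ↦ (hc N hN t).1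
  have hB1 : ∀ t : ℝ, ‖fA1 (1 - (((1 / 2 + S.ε : ℝ) : ℂ) + t * I))‖ ≤ c * (1 + |t|) ^ (1 / 4 : ℝ) :=
    fun t ↦ (hc N hN t).2.1
  have hA3 : ∀ t : ℝ, ‖fA3 N (((1 / 2 + S.ε : ℝ) : ℂ) + t * I)‖ ≤
      c * (N : ℝ) ^ (-(1 / 4 : ℝ)) * (1 + |t|) ^ (1 / 4 : ℝ) := fun t ↦ (hc N hN t).2.2.1
  have hA3' : ∀ t : ℝ, ‖fA3 N (((1 / 2 + S.ε : ℝ) : ℂ) + t * I)‖ ≤ c * (1 + |t|) ^ (1 / 4 : ℝ) := by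
    intro t
    refine (hA3 t).trans ?_
    have : c * (N : ℝ) ^ (-(1 / 4 : ℝ)) ≤ c := mul_le_of_le_one_right hc0.le hN4
    exact mul_le_mul_of_nonneg_right this (by positivity)
  have hB3 : ∀ t : ℝ, ‖fA3 N (1 - (((1 / 2 + S.ε : ℝ) : ℂ) + t * I))‖ ≤ c * (1 + |t|) ^ (1 / 4 : ℝ) :=
    fun t ↦ (hc N hN t).2.2.2.1
  have hA2 : ∀ t : ℝ, ‖fA2 N (((1 / 2 + S.ε : ℝ) : ℂ) + t * I)‖ ≤
      c * (1 + |t|) ^ (2 * S.ε + 3 / 4 - S.δ / 4) := by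
    intro t
    refine (hc N hN t).2.2.2.2.1.trans ?_
    have : c * (N : ℝ) ^ (-S.ε) ≤ c := mul_le_of_le_one_right hc0.le hNε
    exact mul_le_mul_of_nonneg_right this (by positivity)
  have hB2 : ∀ t : ℝ, ‖fA2 N (1 - (((1 / 2 + S.ε : ℝ) : ℂ) + t * I))‖ ≤
      c * (N : ℝ) ^ S.ε * (1 + |t|) ^ (2 * S.ε + 3 / 4 - S.δ / 4) := fun t ↦ (hc N hN t).2.2.2.2.2.1
  -- the seven minor terms
  obtain ⟨i11, b11⟩ := minor_term S cA1 cB1 hc0.le hc0.le hA1 hB1 hq1 hq₀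
  obtain ⟨i13, b13⟩ := minor_term S cA1 cB3 hc0.le hc0.le hA1 hB3 hq1 hq₀
  obtain ⟨i21, b21⟩ := minor_term S cA2 cB1 hc0.le hc0.le hA2 hB1 hq2 hq₀
  obtain ⟨i23, b23⟩ := minor_term S cA2 cB3 hc0.le hc0.le hA2 hB3 hq2 hq₀
  obtain ⟨i31, b31⟩ := minor_term S cA3 cB1 hc0.le hc0.le hA3' hB1 hq1 hq₀
  obtain ⟨i32, b32⟩ := minor_term S cA3 cB2 (by positivity) (by positivity) hA3 hB2 hq3 hq₀
  obtain ⟨i33, b33⟩ := minor_term S cA3 cB3 hc0.le hc0.le hA3' hB3 hq1 hq₀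
  set I₀ : ℝ := ∫ t : ℝ, (1 + ‖t‖) ^ (-1 - S.δ / 8 : ℝ) with hI₀def
  have b32' : ‖∫ t : ℝ, fA3 N (((1 / 2 + S.ε : ℝ) : ℂ) + t * I) *
      fA2 N (1 - (((1 / 2 + S.ε : ℝ) : ℂ) + t * I)) /
      ((((1 / 2 + S.ε : ℝ) : ℂ) + t * I) * (1 - (((1 / 2 + S.ε : ℝ) : ℂ) + t * I)))‖ ≤
      12 * c * c * I₀ := by
    refine b32.trans ?_
    have h0 : 0 ≤ 12 * c * c * I₀ := by positivity
    calc 12 * (c * (N : ℝ) ^ (-(1 / 4 : ℝ))) * (c * (N : ℝ) ^ S.ε) * I₀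
        = 12 * c * c * I₀ * ((N : ℝ) ^ (-(1 / 4 : ℝ)) * (N : ℝ) ^ S.ε) := by ring
      _ ≤ 12 * c * c * I₀ := mul_le_of_le_one_right h0 hN4ε
  -- the main term `A₁(s)A₂(1-s)/(s(1-s)) = Ψ_N(1-s)`
  have hP12 : ∀ t : ℝ, fA1 (((1 / 2 + S.ε : ℝ) : ℂ) + t * I) *
      fA2 N (1 - (((1 / 2 + S.ε : ℝ) : ℂ) + t * I)) /
      ((((1 / 2 + S.ε : ℝ) : ℂ) + t * I) * (1 - (((1 / 2 + S.ε : ℝ) : ℂ) + t * I))) =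
      Psi N (((1 / 2 - S.ε : ℝ) : ℂ) + ((-t : ℝ) : ℂ) * I) := by
    intro t
    have h1s : (1 : ℂ) - (((1 / 2 + S.ε : ℝ) : ℂ) + t * I) =
        ((1 / 2 - S.ε : ℝ) : ℂ) + ((-t : ℝ) : ℂ) * I := by push_cast; ring
    rw [← h1s]
    unfold Psi fA1 fA2
    rw [sub_sub_cancel]
    ring
  have i12 : Integrable fun t : ℝ ↦ fA1 (((1 / 2 + S.ε : ℝ) : ℂ) + t * I) *
      fA2 N (1 - (((1 / 2 + S.ε : ℝ) : ℂ) + t * I)) /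
      ((((1 / 2 + S.ε : ℝ) : ℂ) + t * I) * (1 - (((1 / 2 + S.ε : ℝ) : ℂ) + t * I))) :=
    hMi.comp_neg.congr (Eventually.of_forall fun t ↦ (hP12 t).symm)
  have I12 : (∫ t : ℝ, fA1 (((1 / 2 + S.ε : ℝ) : ℂ) + t * I) *
      fA2 N (1 - (((1 / 2 + S.ε : ℝ) : ℂ) + t * I)) /
      ((((1 / 2 + S.ε : ℝ) : ℂ) + t * I) * (1 - (((1 / 2 + S.ε : ℝ) : ℂ) + t * I)))) =
      ∫ y : ℝ, Psi N (((1 / 2 - S.ε : ℝ) : ℂ) + y * I) := by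
    rw [show (fun t : ℝ ↦ fA1 (((1 / 2 + S.ε : ℝ) : ℂ) + t * I) *
      fA2 N (1 - (((1 / 2 + S.ε : ℝ) : ℂ) + t * I)) /
      ((((1 / 2 + S.ε : ℝ) : ℂ) + t * I) * (1 - (((1 / 2 + S.ε : ℝ) : ℂ) + t * I)))) =
      fun t : ℝ ↦ Psi N (((1 / 2 - S.ε : ℝ) : ℂ) + ((-t : ℝ) : ℂ) * I) from funext hP12]
    exact integral_neg_eq_self (fun y : ℝ ↦ Psi N (((1 / 2 - S.ε : ℝ) : ℂ) + y * I)) volume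
  -- the pointwise decomposition on the line
  have hpt : ∀ t : ℝ, (Real.log N : ℂ) ^ 2 *
      ((1 - riemannZeta (((1 / 2 + S.ε : ℝ) : ℂ) + t * I) *
          levinsonMollifier N (((1 / 2 + S.ε : ℝ) : ℂ) + t * I)) *
        (1 - riemannZeta (1 - (((1 / 2 + S.ε : ℝ) : ℂ) + t * I)) *
          levinsonMollifier N (1 - (((1 / 2 + S.ε : ℝ) : ℂ) + t * I))) /
        ((((1 / 2 + S.ε : ℝ) : ℂ) + t * I) * (1 - (((1 / 2 + S.ε : ℝ) : ℂ) + t * I)))) =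
      (fA1 (((1 / 2 + S.ε : ℝ) : ℂ) + t * I) * fA1 (1 - (((1 / 2 + S.ε : ℝ) : ℂ) + t * I)) /
          ((((1 / 2 + S.ε : ℝ) : ℂ) + t * I) * (1 - (((1 / 2 + S.ε : ℝ) : ℂ) + t * I))) -
        fA1 (((1 / 2 + S.ε : ℝ) : ℂ) + t * I) * fA2 N (1 - (((1 / 2 + S.ε : ℝ) : ℂ) + t * I)) /
          ((((1 / 2 + S.ε : ℝ) : ℂ) + t * I) * (1 - (((1 / 2 + S.ε : ℝ) : ℂ) + t * I))) -
        fA1 (((1 / 2 + S.ε : ℝ) : ℂ) + t * I) * fA3 N (1 - (((1 / 2 + S.ε : ℝ) : ℂ) + t * I)) /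
          ((((1 / 2 + S.ε : ℝ) : ℂ) + t * I) * (1 - (((1 / 2 + S.ε : ℝ) : ℂ) + t * I)))) -
      (fA2 N (((1 / 2 + S.ε : ℝ) : ℂ) + t * I) * fA1 (1 - (((1 / 2 + S.ε : ℝ) : ℂ) + t * I)) /
          ((((1 / 2 + S.ε : ℝ) : ℂ) + t * I) * (1 - (((1 / 2 + S.ε : ℝ) : ℂ) + t * I))) -
        fA2 N (((1 / 2 + S.ε : ℝ) : ℂ) + t * I) * fA2 N (1 - (((1 / 2 + S.ε : ℝ) : ℂ) + t * I)) /
          ((((1 / 2 + S.ε : ℝ) : ℂ) + t * I) * (1 - (((1 / 2 + S.ε : ℝ) : ℂ) + t * I))) -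
        fA2 N (((1 / 2 + S.ε : ℝ) : ℂ) + t * I) * fA3 N (1 - (((1 / 2 + S.ε : ℝ) : ℂ) + t * I)) /
          ((((1 / 2 + S.ε : ℝ) : ℂ) + t * I) * (1 - (((1 / 2 + S.ε : ℝ) : ℂ) + t * I)))) -
      (fA3 N (((1 / 2 + S.ε : ℝ) : ℂ) + t * I) * fA1 (1 - (((1 / 2 + S.ε : ℝ) : ℂ) + t * I)) /
          ((((1 / 2 + S.ε : ℝ) : ℂ) + t * I) * (1 - (((1 / 2 + S.ε : ℝ) : ℂ) + t * I))) -
        fA3 N (((1 / 2 + S.ε : ℝ) : ℂ) + t * I) * fA2 N (1 - (((1 / 2 + S.ε : ℝ) : ℂ) + t * I)) /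
          ((((1 / 2 + S.ε : ℝ) : ℂ) + t * I) * (1 - (((1 / 2 + S.ε : ℝ) : ℂ) + t * I))) -
        fA3 N (((1 / 2 + S.ε : ℝ) : ℂ) + t * I) * fA3 N (1 - (((1 / 2 + S.ε : ℝ) : ℂ) + t * I)) /
          ((((1 / 2 + S.ε : ℝ) : ℂ) + t * I) * (1 - (((1 / 2 + S.ε : ℝ) : ℂ) + t * I)))) := by
    intro t
    have hre : (((1 / 2 + S.ε : ℝ) : ℂ) + t * I).re = 1 / 2 + S.ε := by simp
    have h1re : (1 - (((1 / 2 + S.ε : ℝ) : ℂ) + t * I)).re = 1 / 2 - S.ε := by simp; ring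
    have hζ : riemannZeta (((1 / 2 + S.ε : ℝ) : ℂ) + t * I) ≠ 0 :=
      riemannZeta_ne_zero_of_riemannHypothesis S.hRH (by rw [hre]; linarith)
        (by rw [hre]; intro h; linarith)
    have hζ' : riemannZeta (1 - (((1 / 2 + S.ε : ℝ) : ℂ) + t * I)) ≠ 0 :=
      riemannZeta_ne_zero_of_riemannHypothesis S.hRH (by rw [h1re]; linarith)
        (by rw [h1re]; intro h; linarith)
    have e1 := log_mul_sub_eq N hζ
    have e2 := log_mul_sub_eq N hζ'
    rw [show ∀ f1 f2 D : ℂ, (Real.log N : ℂ) ^ 2 * (f1 * f2 / D) =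
      ((Real.log N : ℂ) * f1) * ((Real.log N : ℂ) * f2) / D from fun f1 f2 D ↦ by ring, e1, e2]
    ring
  -- integrate (abbreviating the nine products)
  set P11 : ℝ → ℂ := fun t : ℝ ↦ fA1 (((1 / 2 + S.ε : ℝ) : ℂ) + t * I) *
    fA1 (1 - (((1 / 2 + S.ε : ℝ) : ℂ) + t * I)) /
    ((((1 / 2 + S.ε : ℝ) : ℂ) + t * I) * (1 - (((1 / 2 + S.ε : ℝ) : ℂ) + t * I))) with hP11
  set P12 : ℝ → ℂ := fun t : ℝ ↦ fA1 (((1 / 2 + S.ε : ℝ) : ℂ) + t * I) *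
    fA2 N (1 - (((1 / 2 + S.ε : ℝ) : ℂ) + t * I)) /
    ((((1 / 2 + S.ε : ℝ) : ℂ) + t * I) * (1 - (((1 / 2 + S.ε : ℝ) : ℂ) + t * I))) with hP12'
  set P13 : ℝ → ℂ := fun t : ℝ ↦ fA1 (((1 / 2 + S.ε : ℝ) : ℂ) + t * I) *
    fA3 N (1 - (((1 / 2 + S.ε : ℝ) : ℂ) + t * I)) /
    ((((1 / 2 + S.ε : ℝ) : ℂ) + t * I) * (1 - (((1 / 2 + S.ε : ℝ) : ℂ) + t * I))) with hP13
  set P21 : ℝ → ℂ := fun t : ℝ ↦ fA2 N (((1 / 2 + S.ε : ℝ) : ℂ) + t * I) *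
    fA1 (1 - (((1 / 2 + S.ε : ℝ) : ℂ) + t * I)) /
    ((((1 / 2 + S.ε : ℝ) : ℂ) + t * I) * (1 - (((1 / 2 + S.ε : ℝ) : ℂ) + t * I))) with hP21
  set P22 : ℝ → ℂ := fun t : ℝ ↦ fA2 N (((1 / 2 + S.ε : ℝ) : ℂ) + t * I) *
    fA2 N (1 - (((1 / 2 + S.ε : ℝ) : ℂ) + t * I)) /
    ((((1 / 2 + S.ε : ℝ) : ℂ) + t * I) * (1 - (((1 / 2 + S.ε : ℝ) : ℂ) + t * I))) with hP22
  set P23 : ℝ → ℂ := fun t : ℝ ↦ fA2 N (((1 / 2 + S.ε : ℝ) : ℂ) + t * I) *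
    fA3 N (1 - (((1 / 2 + S.ε : ℝ) : ℂ) + t * I)) /
    ((((1 / 2 + S.ε : ℝ) : ℂ) + t * I) * (1 - (((1 / 2 + S.ε : ℝ) : ℂ) + t * I))) with hP23
  set P31 : ℝ → ℂ := fun t : ℝ ↦ fA3 N (((1 / 2 + S.ε : ℝ) : ℂ) + t * I) *
    fA1 (1 - (((1 / 2 + S.ε : ℝ) : ℂ) + t * I)) /
    ((((1 / 2 + S.ε : ℝ) : ℂ) + t * I) * (1 - (((1 / 2 + S.ε : ℝ) : ℂ) + t * I))) with hP31
  set P32 : ℝ → ℂ := fun t : ℝ ↦ fA3 N (((1 / 2 + S.ε : ℝ) : ℂ) + t * I) *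
    fA2 N (1 - (((1 / 2 + S.ε : ℝ) : ℂ) + t * I)) /
    ((((1 / 2 + S.ε : ℝ) : ℂ) + t * I) * (1 - (((1 / 2 + S.ε : ℝ) : ℂ) + t * I))) with hP32
  set P33 : ℝ → ℂ := fun t : ℝ ↦ fA3 N (((1 / 2 + S.ε : ℝ) : ℂ) + t * I) *
    fA3 N (1 - (((1 / 2 + S.ε : ℝ) : ℂ) + t * I)) /
    ((((1 / 2 + S.ε : ℝ) : ℂ) + t * I) * (1 - (((1 / 2 + S.ε : ℝ) : ℂ) + t * I))) with hP33
  have hfun : (fun t : ℝ ↦ (Real.log N : ℂ) ^ 2 *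
      ((1 - riemannZeta (((1 / 2 + S.ε : ℝ) : ℂ) + t * I) *
          levinsonMollifier N (((1 / 2 + S.ε : ℝ) : ℂ) + t * I)) *
        (1 - riemannZeta (1 - (((1 / 2 + S.ε : ℝ) : ℂ) + t * I)) *
          levinsonMollifier N (1 - (((1 / 2 + S.ε : ℝ) : ℂ) + t * I))) /
        ((((1 / 2 + S.ε : ℝ) : ℂ) + t * I) * (1 - (((1 / 2 + S.ε : ℝ) : ℂ) + t * I))))) =
      fun t : ℝ ↦ (P11 t - P12 t - P13 t) - (P21 t - P22 t - P23 t) - (P31 t - P32 t - P33 t) :=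
    funext hpt
  have hI1 : Integrable (fun t : ℝ ↦ P11 t - P12 t) := i11.sub i12
  have hI2 : Integrable (fun t : ℝ ↦ P11 t - P12 t - P13 t) := hI1.sub i13
  have hI3 : Integrable (fun t : ℝ ↦ P21 t - P22 t) := i21.sub hZZi
  have hI4 : Integrable (fun t : ℝ ↦ P21 t - P22 t - P23 t) := hI3.sub i23
  have hI5 : Integrable (fun t : ℝ ↦ P31 t - P32 t) := i31.sub i32
  have hI6 : Integrable (fun t : ℝ ↦ P31 t - P32 t - P33 t) := hI5.sub i33
  have hI7 : Integrable (fun t : ℝ ↦ (P11 t - P12 t - P13 t) - (P21 t - P22 t - P23 t)) := hI2.sub hI4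
  have E0 : (∫ t : ℝ, (P11 t - P12 t - P13 t) - (P21 t - P22 t - P23 t) - (P31 t - P32 t - P33 t)) =
      (∫ t : ℝ, (P11 t - P12 t - P13 t) - (P21 t - P22 t - P23 t)) -
        ∫ t : ℝ, (P31 t - P32 t - P33 t) := integral_sub hI7 hI6
  have E0' : (∫ t : ℝ, (P11 t - P12 t - P13 t) - (P21 t - P22 t - P23 t)) =
      (∫ t : ℝ, (P11 t - P12 t - P13 t)) - ∫ t : ℝ, (P21 t - P22 t - P23 t) := integral_sub hI2 hI4
  have E1 : (∫ t : ℝ, (P11 t - P12 t - P13 t)) = (∫ t : ℝ, (P11 t - P12 t)) - ∫ t : ℝ, P13 t :=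
    integral_sub hI1 i13
  have E2 : (∫ t : ℝ, (P11 t - P12 t)) = (∫ t : ℝ, P11 t) - ∫ t : ℝ, P12 t := integral_sub i11 i12
  have E3 : (∫ t : ℝ, (P21 t - P22 t - P23 t)) = (∫ t : ℝ, (P21 t - P22 t)) - ∫ t : ℝ, P23 t :=
    integral_sub hI3 i23
  have E4 : (∫ t : ℝ, (P21 t - P22 t)) = (∫ t : ℝ, P21 t) - ∫ t : ℝ, P22 t := integral_sub i21 hZZi
  have E5 : (∫ t : ℝ, (P31 t - P32 t - P33 t)) = (∫ t : ℝ, (P31 t - P32 t)) - ∫ t : ℝ, P33 t :=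
    integral_sub hI5 i33
  have E6 : (∫ t : ℝ, (P31 t - P32 t)) = (∫ t : ℝ, P31 t) - ∫ t : ℝ, P32 t := integral_sub i31 i32
  have hint_eq : (Real.log N : ℂ) ^ 2 *
      (∫ t : ℝ, (1 - riemannZeta (((1 / 2 + S.ε : ℝ) : ℂ) + t * I) *
          levinsonMollifier N (((1 / 2 + S.ε : ℝ) : ℂ) + t * I)) *
        (1 - riemannZeta (1 - (((1 / 2 + S.ε : ℝ) : ℂ) + t * I)) *
          levinsonMollifier N (1 - (((1 / 2 + S.ε : ℝ) : ℂ) + t * I))) /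
        ((((1 / 2 + S.ε : ℝ) : ℂ) + t * I) * (1 - (((1 / 2 + S.ε : ℝ) : ℂ) + t * I)))) =
      ((∫ t : ℝ, P11 t) - (∫ y : ℝ, Psi N (((1 / 2 - S.ε : ℝ) : ℂ) + y * I)) - ∫ t : ℝ, P13 t) -
      ((∫ t : ℝ, P21 t) - (∫ t : ℝ, P22 t) - ∫ t : ℝ, P23 t) -
      ((∫ t : ℝ, P31 t) - (∫ t : ℝ, P32 t) - ∫ t : ℝ, P33 t) := by
    rw [← integral_const_mul, hfun, ← I12]
    linear_combination E0 + E0' + E1 + E2 - E3 - E4 - E5 - E6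
  rw [hint_eq]
  -- collect
  have htri : ∀ I11 M I13 I21 I22 I23 I31 I32 I33 X : ℂ,
      ‖(I11 - M - I13) - (I21 - I22 - I23) - (I31 - I32 - I33) - X‖ ≤
        ‖I11‖ + ‖I13‖ + (‖I21‖ + ‖I22‖ + ‖I23‖) + (‖I31‖ + ‖I32‖ + ‖I33‖) + ‖M + X‖ := by
    intro I11 M I13 I21 I22 I23 I31 I32 I33 X
    calc ‖(I11 - M - I13) - (I21 - I22 - I23) - (I31 - I32 - I33) - X‖
        = ‖(I11 - I13) - (I21 - I22 - I23) - (I31 - I32 - I33) - (M + X)‖ := by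
          congr 1; ring
      _ ≤ ‖(I11 - I13) - (I21 - I22 - I23) - (I31 - I32 - I33)‖ + ‖M + X‖ := norm_sub_le _ _
      _ ≤ ‖(I11 - I13) - (I21 - I22 - I23)‖ + ‖I31 - I32 - I33‖ + ‖M + X‖ := by
          gcongr; exact norm_sub_le _ _
      _ ≤ (‖I11 - I13‖ + ‖I21 - I22 - I23‖) + (‖I31 - I32‖ + ‖I33‖) + ‖M + X‖ := by
          gcongr
          · exact norm_sub_le _ _
          · exact norm_sub_le _ _
      _ ≤ ((‖I11‖ + ‖I13‖) + (‖I21 - I22‖ + ‖I23‖)) + ((‖I31‖ + ‖I32‖) + ‖I33‖) + ‖M + X‖ := by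
          gcongr
          · exact norm_sub_le _ _
          · exact norm_sub_le _ _
          · exact norm_sub_le _ _
      _ ≤ ((‖I11‖ + ‖I13‖) + ((‖I21‖ + ‖I22‖) + ‖I23‖)) + ((‖I31‖ + ‖I32‖) + ‖I33‖) + ‖M + X‖ := by
          gcongr; exact norm_sub_le _ _
      _ = _ := by ring
  refine (htri _ _ _ _ _ _ _ _ _ _).trans ?_
  have c11 : ‖∫ t : ℝ, P11 t‖ ≤ 12 * c * c * I₀ := b11
  have c13 : ‖∫ t : ℝ, P13 t‖ ≤ 12 * c * c * I₀ := b13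
  have c21 : ‖∫ t : ℝ, P21 t‖ ≤ 12 * c * c * I₀ := b21
  have c22 : ‖∫ t : ℝ, P22 t‖ ≤ Kz := hZZb
  have c23 : ‖∫ t : ℝ, P23 t‖ ≤ 12 * c * c * I₀ := b23
  have c31 : ‖∫ t : ℝ, P31 t‖ ≤ 12 * c * c * I₀ := b31
  have c32 : ‖∫ t : ℝ, P32 t‖ ≤ 12 * c * c * I₀ := b32'
  have c33 : ‖∫ t : ℝ, P33 t‖ ≤ 12 * c * c * I₀ := b33
  have cM := hMb
  linarith

/-! ## Step 4: the constant -/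

/-- Under simple zeros, `∑_ρ 1/(ρ(1−ρ)) = β` over the distinct non-trivial zeros (Nicolas's
`β = ∑_ρ m(ρ)/(ρ(1−ρ))`, `hasSum_zeroOrder_div_mul_one_sub`). [cite: Nicolas2012, (1.3)] -/
theorem tsum_inv_mul_one_sub_eq
    (hsimp : ∀ ρ : ℂ, riemannZeta ρ = 0 → 0 < ρ.re → ρ.re < 1 → deriv riemannZeta ρ ≠ 0) :
    ∑' ρ : ZetaZeros.riemannZetaNontrivialZeros, (1 : ℂ) / ((ρ : ℂ) * (1 - ρ)) = (nicolasBeta : ℂ) := by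
  have h : HasSum (fun ρ : ZetaZeros.riemannZetaNontrivialZeros ↦
      (riemannZetaZeroOrder (ρ : ℂ) : ℂ) / ((ρ : ℂ) * (1 - ρ))) (nicolasBeta : ℂ) :=
    hasSum_zeroOrder_div_mul_one_sub
  refine (h.congr_fun fun ρ ↦ ?_).tsum_eq
  have h1 : riemannZetaZeroOrder (ρ : ℂ) = 1 :=
    (riemannZetaZeroOrder_eq_one_iff_deriv_ne_zero ρ.2).2 (ntz_deriv_ne_zero hsimp ρ.2)
  rw [h1]; push_cast; rfl

/-- `β = 2 + γ − log π − 2 log 2 = 2 + γ − log 4π`. [cite: BettinConreyFarmer2013, §1 ("= 2 + γ − log 4π")] -/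
theorem nicolasBeta_eq : nicolasBeta = 2 + Real.eulerMascheroniConstant - Real.log (4 * π) := by
  unfold nicolasBeta
  rw [Real.log_mul (by norm_num) Real.pi_pos.ne', show (4 : ℝ) = 2 ^ 2 by norm_num, Real.log_pow]
  push_cast
  ring

end BCF

/-! ## Theorem 1 -/

open BCF in
/-- **Bettin–Conrey–Farmer 2013, Theorem 1 (discharged).** Under RH and condition (2) (with the
simplicity of the zeros it presupposes),
`(1/2π) ∫ |1 − ζV_N(1/2+it)|² dt/(1/4+t²) ~ (2 + γ − log 4π)/log N`.
[cite: BettinConreyFarmer2013, Thm. 1] -/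
theorem BettinConreyFarmer2013_thm1_holds : BettinConreyFarmer2013_thm1 := by
  intro hRH hhyp
  obtain ⟨hsimp, δ, hδ, C, hC⟩ := hhyp
  -- the standing data, with `δ ≤ 1` and `ε = min(1/16, δ/16)`
  have hδ' : 0 < min δ 1 := lt_min hδ one_pos
  have hδ'1 : min δ 1 ≤ 1 := min_le_right _ _
  have hC' : ∀ T : ℝ, 2 ≤ T →
      ∑ᶠ ρ ∈ zetaZeroBox 0 T, 1 / ‖deriv riemannZeta ρ‖ ^ 2 ≤ max C 0 * T ^ (3 / 2 - min δ 1) := by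
    intro T hT
    refine (hC T hT).trans ?_
    have hT1 : 1 ≤ T := by linarith
    calc C * T ^ (3 / 2 - δ) ≤ max C 0 * T ^ (3 / 2 - δ) :=
          mul_le_mul_of_nonneg_right (le_max_left _ _) (by positivity)
      _ ≤ max C 0 * T ^ (3 / 2 - min δ 1) :=
          mul_le_mul_of_nonneg_left
            (Real.rpow_le_rpow_of_exponent_le hT1 (by linarith [min_le_left δ 1])) (le_max_right _ _)
  have hε : 0 < min (1 / 16 : ℝ) (min δ 1 / 16) := lt_min (by norm_num) (by linarith)
  have hε16 : min (1 / 16 : ℝ) (min δ 1 / 16) ≤ 1 / 16 := min_le_left _ _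
  have hεδ : 16 * min (1 / 16 : ℝ) (min δ 1 / 16) ≤ min δ 1 := by
    have := min_le_right (1 / 16 : ℝ) (min δ 1 / 16); linarith
  let S : Setting := ⟨min δ 1, max C 0, min (1 / 16 : ℝ) (min δ 1 / 16), hδ', hδ'1, hε, hε16, hεδ,
    hRH, hsimp, hC'⟩
  obtain ⟨K, hK⟩ := exists_line_bound S
  have hβ0 : 0 < 2 + Real.eulerMascheroniConstant - Real.log (4 * π) := by
    rw [← nicolasBeta_eq]; linarith [nicolasBeta_gt]
  have hπ : (0 : ℝ) < 2 * π := by positivity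
  -- the key estimate
  have hmain : ∀ N : ℕ, 2 ≤ N →
      |bcfDistSq N - (2 + Real.eulerMascheroniConstant - Real.log (4 * π)) / Real.log N| ≤
        K / (2 * π) / Real.log N ^ 2 := by
    intro N hN
    have hL : 0 < Real.log N := Real.log_pos (by exact_mod_cast hN)
    have h1 := bcfDistSq_eq_integral N
    rw [integral_shift S hN] at h1
    have h2 := hK N hN
    rw [tsum_inv_mul_one_sub_eq hsimp, nicolasBeta_eq] at h2
    have alg : ∀ (L d β : ℝ) (J : ℂ), (d : ℂ) = 1 / (2 * π) * J →
        ((L ^ 2 * d - L * β : ℝ) : ℂ) =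
          ((1 / (2 * π) : ℝ) : ℂ) * ((L : ℂ) ^ 2 * J - 2 * π * (L : ℂ) * (β : ℂ)) := by
      intro L d β J h
      have hπ' : (π : ℂ) ≠ 0 := by exact_mod_cast Real.pi_pos.ne'
      push_cast
      rw [h]
      field_simp
    have h3 := alg (Real.log N) (bcfDistSq N)
      (2 + Real.eulerMascheroniConstant - Real.log (4 * π)) _ h1
    have h4 : |(Real.log N) ^ 2 * bcfDistSq N -
        Real.log N * (2 + Real.eulerMascheroniConstant - Real.log (4 * π))| ≤ K / (2 * π) := by
      rw [← Real.norm_eq_abs, ← Complex.norm_real, h3, norm_mul, Complex.norm_real,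
        Real.norm_of_nonneg (by positivity)]
      calc 1 / (2 * π) * _ ≤ 1 / (2 * π) * K := mul_le_mul_of_nonneg_left h2 (by positivity)
        _ = K / (2 * π) := by ring
    have hL' : Real.log N ≠ 0 := hL.ne'
    have h5 : bcfDistSq N - (2 + Real.eulerMascheroniConstant - Real.log (4 * π)) / Real.log N =
        ((Real.log N) ^ 2 * bcfDistSq N -
          Real.log N * (2 + Real.eulerMascheroniConstant - Real.log (4 * π))) / Real.log N ^ 2 := by
      field_simp
    rw [h5, abs_div, abs_of_pos (by positivity : (0 : ℝ) < Real.log N ^ 2)]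
    exact div_le_div_of_nonneg_right h4 (by positivity)
  -- the asymptotic equivalence
  rw [Asymptotics.IsEquivalent, Asymptotics.isLittleO_iff]
  intro c hc
  have hev : ∀ᶠ N : ℕ in atTop, K / (2 * π) / (c * (2 + Real.eulerMascheroniConstant -
      Real.log (4 * π))) + 1 ≤ Real.log N :=
    (Real.tendsto_log_atTop.comp tendsto_natCast_atTop_atTop).eventually_ge_atTop _
  filter_upwards [hev, eventually_ge_atTop 2] with N hlog hN
  have hlog' : K / (2 * π) / (c * (2 + Real.eulerMascheroniConstant - Real.log (4 * π))) + 1 ≤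
      Real.log N := hlog
  have hL : 0 < Real.log N := Real.log_pos (by exact_mod_cast hN)
  have hL' : Real.log N ≠ 0 := hL.ne'
  set β : ℝ := 2 + Real.eulerMascheroniConstant - Real.log (4 * π) with hβ
  simp only [Pi.sub_apply, Real.norm_eq_abs]
  have hKL : K / (2 * π) ≤ c * β * Real.log N := by
    have h := (div_le_iff₀ (by positivity : 0 < c * β)).1
      (by linarith : K / (2 * π) / (c * β) ≤ Real.log N)
    linarith
  calc |bcfDistSq N - β / Real.log N| ≤ K / (2 * π) / Real.log N ^ 2 := hmain N hN
    _ ≤ c * β * Real.log N / Real.log N ^ 2 := div_le_div_of_nonneg_right hKL (by positivity)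
    _ = c * |β / Real.log N| := by
        rw [abs_of_pos (div_pos hβ0 hL), sq, mul_div_mul_right _ _ hL', mul_div_assoc]

end Literature.NumberTheory.LFunctions

end
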